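import Literature.Probability.Percolation.BoxCrossingLowerBound
import Literature.Probability.Percolation.LatticePathArcs
import Literature.Probability.Percolation.AnnulusCircuitsProofs
import Literature.Topology.PlaneTopology.Crosscut
import HarnessLib

/-!
# The dual cross-cut and the RSW upper bound for conformal-rectangle crossings

Topic: Probability / Percolation. The "bounded away from `1`" half of the RSW non-degeneracy of
conformal-rectangle crossings (Grimmett, *Probability on Graphs* (2018), §5.7 p. 176 and
Exercise 5.6; Bollobás–Riordan, *Percolation* (2006), Ch. 3 §1 for the planar dual of bond
percolation on `ℤ²`, Ch. 7 §2 for the same argument on the triangular lattice) for H21's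
discretisation `discreteCrossing` (`Crossings.lean`), and the assembly of the corrected fact
`Literature.Probability.Percolation.discreteCrossingProb_bounds_nullFrontier` (`BoxCrossing.lean`) from the named
literature facts it rests on.

**Deterministic part I — the dual cross-cut** (`exists_dual_crosscut`): from a chain of
*dual-open* circuits and dual-open long rectangle crossings joining neighbourhoods of interior
points `b' ∈ arc 1°`, `d' ∈ arc 3°` of a conformal rectangle `R`, together with dual-open
circuits around `b'` and `d'`, we extract a **cross-cut** of the Jordan domain (Newman 1939,
Ch. V §11: a simple arc in `Ω̄` meeting `∂Ω` exactly in its two end-points) from a point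
`R.boundary s`, `s ∈ (mark 1, mark 2)`, to a point `R.boundary t`, `t ∈ (mark 3, mark 0 + 1)`,
every point of which lies on the planar trace `δ (e + (½, ½))` of a dual-open edge `e` and is
either within `3√2 L δ + 2δ` of `b'` or of `d'` or has its `w/2`-ball inside `Ω`. Ingredients:
`exists_first_exit` (first exit parameter of a segment from an open set); `exists_dual_exit` (a
dual-open circuit enclosing the dual site nearest to a boundary point has a dual edge whose
planar trace leaves `Ω`, reached from the chain through dual edges whose traces stay in `Ω`:
the circuit meets both the chain, by `EnclosesPoint.inter_image_meshTrace_nonempty`, and the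
exterior of the Jordan curve, by the Jordan curve theorem); parameter location of boundary
points deep inside `arc 1` / `arc 3` (`exists_mem_Ioo_of_mem_arc_one/three`); gluing of the exit
sub-segment at `b'`, the dual lattice *path* (a simple arc, `isSimpleArc_walkTrace`) and the exit
sub-segment at `d'` into a simple arc (`IsSimpleArc.union`), the pieces meeting only at the
joints (`segment_inter_image_walkTrace_subset`).

**Deterministic part II — blocking** (`not_mem_discreteCrossing_of_crosscut`, Newman's cross-cut
theorem `Newman1939_crosscut` via `JordanDomain.inter_nonempty_of_crosscut`): such a cross-cut
excludes `ω ∈ discreteCrossing Ω δ (arc 0) (arc 2)`: an open `Ω_δ`-path from the discrete arc of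
`arc 0` to that of `arc 2`, extended at each end along a lattice edge to its first frontier
point (`exists_frontier_exit_of_mem_meshBoundary`), is a connected subset of `Ω̄` joining the two
boundary arcs cut off by `Λ`, hence meets `Λ`; but an open primal edge cannot cross a dual-open
dual edge (`disjoint_walkTrace_image_edgeTrace`, `LatticePathArcs.lean`), and the end extensions
are shallow and far from the ends of `Λ`. The parameter bookkeeping on the boundary loop
(`exists_forall_dist_boundary_lt`, `crosscut_param_bounds`, `disjoint_image_Icc_arc_zero/two`,
`exists_Ioo_of_infDist_arc_zero/two`) shows that the end-points of the dual cross-cut sit a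
definite `η` inside `(mark 1, mark 2)` and `(mark 3, mark 0 + 1)` and that frontier points within
`2δ` of `arc 0` (resp. `arc 2`) lie strictly inside the complementary parameter arcs, for `δ`
below a constant of `R` (continuity and injectivity of the boundary loop, compactness).

**Probability and assembly.** `discreteCrossingProb_upperBound`: the dual chain events have
`P_{1/2}`-probability `≥ c' > 0` uniformly in `δ` because the law of `dualConfig` under `P_{1/2}`
is `P_{1/2}` (`bondPercolation_map_dualConfig_holds`) and by the lower-bound estimate
`le_real_chainEvents`; with parts I–II, `P_{1/2}[C_δ] ≤ 1 - c'` for small `δ` — for *every*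
conformal rectangle (no hypothesis on the boundary measure: the dual barrier lives on the dual
lattice and never refers to `Ω_δ`). `discreteCrossingProb_bounds_nullFrontier_of`: together with
`discreteCrossingProb_lowerBound_of_nullFrontier` (`BoxCrossingLowerBound.lean`) this proves the
corrected fact `discreteCrossingProb_bounds_nullFrontier` from `rsw_half`,
`Grimmett1999_openCircuitAround_half`, `JordanCurveTheorem` and `Newman1939_crosscut`
(`discreteCrossingProb_bounds_nullFrontier_of_facts` feeds in `rsw_half_holds` of `RSWLemma.lean`,
and `discreteCrossingProb_bounds_nullFrontier_of_JCT` also `Grimmett1999_openCircuitAround_half_holds`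
of `AnnulusCircuitsProofs.lean`, leaving the two plane-topology facts `JordanCurveTheorem` and
`Newman1939_crosscut` as the only hypotheses); hence
(`discreteCrossingProb_clusterPt_mem_Ioo_of_nullFrontier`) the cluster-point statement of
`discreteCrossingProb_clusterPt_mem_Ioo` for conformal rectangles with Lebesgue-null boundary,
while its upper half `c < 1` holds for all conformal rectangles
(`lt_one_of_mapClusterPt_discreteCrossingProb`).

Mathlib anchors: `segment`, `Convex.segment_subset`, `IsClosed.csInf_mem` (first exit as an
infimum), `SimpleGraph.Walk.bypass` (`bypass_isPath`), `SimpleGraph.Walk.transfer`,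
`SimpleGraph.Walk.mapLe`, `Metric.infDist`, `Function.Periodic.exists_mem_Ico`,
`IsCompact.uniformContinuousOn_of_continuous`, `MeasureTheory.Measure.map_apply`,
`MeasureTheory.measureReal_union`; H21 anchors: `ChainCluster`, `exists_chainCluster`
(`CrossingChains.lean`), `exists_chainData`, `le_real_chainEvents`, `measurableSet_chainEvents`,
`floor_scale_bounds`, `abs_nearestSite_sub_le`, `three_sqrt_two_mul_le`,
`discreteCrossingProb_lowerBound_of_nullFrontier` (`BoxCrossingLowerBound.lean`),
`isSimpleArc_walkTrace`, `dualOffset`, `dualScale`, `eq_dualEdge_of_mem_edgeTrace_inter`,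
`disjoint_walkTrace_image_edgeTrace` (`LatticePathArcs.lean`), `JordanDomain.IsCrosscut`,
`IsSimpleArc`, `Newman1939_crosscut`, `JordanDomain.inter_nonempty_of_crosscut`
(`Crosscut.lean`), `IsSimpleArc.union`, `IsSimpleArc.subsegment` (`SimpleArcs.lean`),
`JordanDomain.exterior_of_JCT`, `MarkedDomain.boundary_not_mem_arc`
(`PlanarDomainsTopology.lean`), `exists_mem_frontier_of_mem_meshBoundary`,
`infDist_le_of_mem_discreteArc`, `discreteArc_inter_eq_empty_of_lt` (`BoxCrossingProofs.lean`),
`exists_pos_forall_lt_infDist` (`MeshDomainBulk.lean`), `dualConfig`, `dualEdge`,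
`bondPercolation_map_dualConfig_holds` (`Crossings.lean`), `measurable_dualConfig`
(`PlanarDuality.lean`), `symm_half` (`RSW.lean`), `rsw_half_holds` (`RSWLemma.lean`),
`Grimmett1999_openCircuitAround_half_holds` (`AnnulusCircuitsProofs.lean`),
`discreteCrossingProb_bounds_nullFrontier` (`BoxCrossing.lean`).

## References
* G. Grimmett, *Probability on Graphs*, 2nd ed. (2018), §5.7 p. 176, Ex. 5.5–5.6 p. 186
  [Grimmett2018].
* G. Grimmett, *Percolation*, 2nd ed. (1999), §11.7 (11.70)–(11.72) [GrimmettPercolation1999].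
* B. Bollobás, O. Riordan, *Percolation*, CUP (2006), Ch. 3 §1, Ch. 7 §2 [BollobasRiordan2006].
* M. H. A. Newman, *Elements of the topology of plane sets of points* (1939), Ch. V §11
  [Newman1939].
-/

namespace Literature.Probability.Percolation

open Set Metric MeasureTheory Complex Filter _root_.Topology

noncomputable section

/-! ### First exit of a segment from an open set -/

/-- **First exit.** If `p` lies in the open set `Ω` but the segment `[p, q]` does not, there is
a first parameter `t ∈ (0, 1]` at which `p + t (q - p)` leaves `Ω`; that point is on the
frontier of `Ω`, and the half-open initial segment before it lies in `Ω`. [folklore] -/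
theorem exists_first_exit {Ω : Set ℂ} (hΩ : IsOpen Ω) {p q : ℂ} (hp : p ∈ Ω)
    (h : ¬ segment ℝ p q ⊆ Ω) :
    ∃ t : ℝ, 0 < t ∧ t ≤ 1 ∧ p + t • (q - p) ∈ frontier Ω ∧ p + t • (q - p) ∉ Ω ∧
      ∀ s : ℝ, 0 ≤ s → s < t → p + s • (q - p) ∈ Ω := by
  set γ : ℝ → ℂ := fun s => p + s • (q - p) with hγ
  have hγc : Continuous γ := by fun_prop
  set S : Set ℝ := {s ∈ Icc (0 : ℝ) 1 | γ s ∉ Ω} with hS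
  have hSne : S.Nonempty := by
    by_contra hne
    apply h
    rw [segment_eq_image']
    rintro _ ⟨s, hs, rfl⟩
    by_contra hs'
    exact hne ⟨s, hs, hs'⟩
  have hSc : IsClosed S := by
    have : S = Icc 0 1 ∩ γ ⁻¹' Ωᶜ := by ext s; simp [hS]
    rw [this]
    exact isClosed_Icc.inter (hΩ.isClosed_compl.preimage hγc)
  have hSb : BddBelow S := ⟨0, fun s hs => hs.1.1⟩
  set t := sInf S with ht
  have htS : t ∈ S := hSc.csInf_mem hSne hSb
  have ht0 : 0 < t := by
    rcases htS.1.1.eq_or_lt with h0 | h0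
    · exfalso; apply htS.2; rw [← h0]; simpa [hγ] using hp
    · exact h0
  have hbelow : ∀ s : ℝ, 0 ≤ s → s < t → γ s ∈ Ω := by
    intro s hs0 hst
    by_contra hs
    have : t ≤ s := csInf_le hSb ⟨⟨hs0, hst.le.trans htS.1.2⟩, hs⟩
    linarith
  refine ⟨t, ht0, htS.1.2, ?_, htS.2, hbelow⟩
  rw [hΩ.frontier_eq, Set.mem_sdiff]  -- frontier = closure \ Ω
  refine ⟨?_, htS.2⟩
  have htend : Tendsto γ (𝓝[<] t) (𝓝 (γ t)) := hγc.continuousAt.continuousWithinAt.tendsto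
  refine mem_closure_of_tendsto htend ?_
  filter_upwards [Ioo_mem_nhdsLT ht0] with s hs
  exact hbelow s hs.1.le hs.2

/-! ### Enclosing circuits meet connecting sets: translated form -/

/-- Translated mesh version of `EnclosesPoint.inter_meshTrace_nonempty`: with all lattice
objects displaced by a fixed planar vector `τ` (as for the planar dual lattice
`δ (ℤ² + (½, ½)) = δ ℤ² + τ`). [folklore] -/
theorem EnclosesPoint.inter_image_meshTrace_nonempty {δ : ℝ} (hδ : 0 < δ) (τ : ℂ)
    {v u u' : LatticeModels.Site 2} {l : ℕ} {w : (LatticeModels.zdGraph 2).Walk u u'}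
    (hs : ∀ x ∈ w.support, x - v ∈ LatticeModels.annulus 2 l (3 * l))
    (hw : EnclosesPoint (LatticeModels.Site.toComplex v) w) {S : Set ℂ} (hS : IsPreconnected S) {p q : ℂ}
    (hp : p ∈ S) (hpn : dist p (LatticeModels.meshPoint δ v + τ) < ((l : ℝ) + 1) * δ) (hq : q ∈ S)
    (hqn : 3 * Real.sqrt 2 * l * δ < dist q (LatticeModels.meshPoint δ v + τ)) :
    (S ∩ (· + τ) '' meshTrace δ w).Nonempty := by
  set S' : Set ℂ := (fun z => z - τ) '' S with hS'
  have hS'c : IsPreconnected S' := hS.image _ (by fun_prop)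
  have hd : ∀ z, dist (z - τ) (LatticeModels.meshPoint δ v) = dist z (LatticeModels.meshPoint δ v + τ) := fun z => by
    rw [dist_eq_norm, dist_eq_norm]; congr 1; ring
  obtain ⟨z, ⟨s, hsS, rfl⟩, hz⟩ := hw.inter_meshTrace_nonempty hδ hs hS'c (mem_image_of_mem _ hp)
    (by rw [hd]; exact hpn) (mem_image_of_mem _ hq) (by rw [hd]; exact hqn)
  exact ⟨s, hsS, s - τ, hz, by ring⟩

/-! ### Planar dual edges at mesh `δ` -/

/-- Points of a planar dual edge are within `δ` of its first endpoint (for `δ ≥ 0`). [folklore] -/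
theorem dist_le_of_mem_image_dualScale_edgeTrace {δ : ℝ} (hδ : 0 ≤ δ) {x y : LatticeModels.Site 2}
    (hxy : (LatticeModels.zdGraph 2).Adj x y) {z : ℂ} (hz : z ∈ dualScale δ '' edgeTrace s(x, y)) :
    dist z (dualScale δ (LatticeModels.Site.toComplex x)) ≤ δ := by
  have hd : dist (dualScale δ (LatticeModels.Site.toComplex y)) (dualScale δ (LatticeModels.Site.toComplex x)) = δ := by
    rw [dist_dualScale δ (hδ := hδ), ← dist_meshPoint_meshPoint hδ,
      Literature.Probability.Percolation.dist_meshPoint_of_adj hxy.symm, abs_of_nonneg hδ]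
  rw [image_dualScale_edgeTrace] at hz
  have hsub : segment ℝ (dualScale δ (LatticeModels.Site.toComplex x)) (dualScale δ (LatticeModels.Site.toComplex y)) ⊆
      closedBall (dualScale δ (LatticeModels.Site.toComplex x)) δ :=
    (convex_closedBall _ _).segment_subset (mem_closedBall_self hδ) (mem_closedBall.2 hd.le)
  exact mem_closedBall.1 (hsub hz)

/-- The dual configuration lives on lattice edges. [folklore] -/
theorem dualConfig_subset_edgeSet (ω : BondConfig (LatticeModels.Site 2)) : dualConfig ω ⊆ (LatticeModels.zdGraph 2).edgeSet :=
  fun _ he => (mem_dualConfig_iff.1 he).1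

/-! ### Exit of a dual circuit near a boundary point -/

/-- **Exit of the dual anchoring circuit.** Let `W` be a circuit of `u + A(L)`, open in the
dual configuration, around the dual vertex `u` nearest to `b' - δ (½, ½)` for a frontier point
`b'` of the Jordan domain `R`, and let `D ⊆ E(ℤ²)` be an edge set whose planar dual edges lie in
`Ω` and whose (preconnected) trace joins a point within `(L + 1) δ` of `δ u` to a point beyond
`3√2 L δ`. Then `D` and `W` share a vertex `j`, and (Jordan curve theorem: the exterior of `R`
reaches `b'`) following `W` from `j` one meets a first dual edge `{x, y}` whose planar dual
edge leaves `Ω`, at a first exit point `f` on the frontier; the initial sub-walk `W₁` from `j`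
to `x` has all its planar dual edges inside `Ω`, and everything stays within `3√2 L δ + δ` of
`b'`. [folklore] -/
theorem exists_dual_exit (hJ : Literature.Topology.PlaneTopology.JordanCurveTheorem) (R : RandomPlanarGeometry.JordanDomain) {b' : ℂ}
    (hb' : b' ∈ frontier R.carrier) {δ : ℝ} (hδ : 0 < δ) {ω : BondConfig (LatticeModels.Site 2)} {L : ℕ}
    (hL : 1 ≤ L)
    (hA : dualConfig ω ∈ openCircuitAroundAt (LatticeModels.nearestSite δ (b' - (δ : ℂ) * dualOffset)) L)
    {D : Set (Sym2 (LatticeModels.Site 2))} (hDE : ∀ e ∈ D, e ∈ (LatticeModels.zdGraph 2).edgeSet)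
    (hDpre : IsPreconnected (⋃ e ∈ D, edgeTrace e))
    (hDΩ : ∀ e ∈ D, dualScale δ '' edgeTrace e ⊆ R.carrier)
    {p q : ℂ} (hp : p ∈ ⋃ e ∈ D, edgeTrace e) (hq : q ∈ ⋃ e ∈ D, edgeTrace e)
    (hpn : dist (meshScale δ p) (LatticeModels.meshPoint δ (LatticeModels.nearestSite δ (b' - (δ : ℂ) * dualOffset))) <
      ((L : ℝ) + 1) * δ)
    (hqn : 3 * Real.sqrt 2 * L * δ <
      dist (meshScale δ q) (LatticeModels.meshPoint δ (LatticeModels.nearestSite δ (b' - (δ : ℂ) * dualOffset)))) :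
    ∃ (j x y : LatticeModels.Site 2) (W₁ : (LatticeModels.zdGraph 2).Walk j x) (t : ℝ) (f : ℂ),
      j ∈ edgeVerts D ∧ (LatticeModels.zdGraph 2).Adj x y ∧ s(x, y) ∈ dualConfig ω ∧
      (∀ e ∈ W₁.edges, e ∈ dualConfig ω) ∧
      (∀ e ∈ W₁.edges, dualScale δ '' edgeTrace e ⊆ R.carrier) ∧
      ¬ dualScale δ '' edgeTrace s(x, y) ⊆ R.carrier ∧
      (∀ z ∈ W₁.support, dist (dualScale δ (LatticeModels.Site.toComplex z)) b' ≤ 3 * Real.sqrt 2 * L * δ + δ) ∧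
      dist (dualScale δ (LatticeModels.Site.toComplex y)) b' ≤ 3 * Real.sqrt 2 * L * δ + δ ∧
      0 < t ∧ t ≤ 1 ∧
      f = dualScale δ (LatticeModels.Site.toComplex x) +
        t • (dualScale δ (LatticeModels.Site.toComplex y) - dualScale δ (LatticeModels.Site.toComplex x)) ∧
      f ∈ frontier R.carrier ∧ f ∉ R.carrier ∧
      ∀ s : ℝ, 0 ≤ s → s < t → dualScale δ (LatticeModels.Site.toComplex x) +
        s • (dualScale δ (LatticeModels.Site.toComplex y) - dualScale δ (LatticeModels.Site.toComplex x)) ∈ R.carrier := by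
  set τ : ℂ := (δ : ℂ) * dualOffset with hτ
  set u := LatticeModels.nearestSite δ (b' - τ) with hu
  obtain ⟨a, W, hWc, hs, hopen, henc⟩ := hA
  -- the common vertex `j`
  have hTpre : IsPreconnected (meshScale δ '' ⋃ e ∈ D, edgeTrace e) :=
    hDpre.image _ (meshScale δ).continuous_of_finiteDimensional.continuousOn
  obtain ⟨j, hjD, hjW⟩ := exists_mem_edgeVerts_of_inter_meshTrace_nonempty hδ.ne' hDE
    (henc.inter_meshTrace_nonempty hδ hs hTpre (mem_image_of_mem _ hp) hpn
      (mem_image_of_mem _ hq) hqn)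
  -- the exterior reaches the planar dual circuit
  obtain ⟨hEc, -, hEb⟩ := R.exterior_of_JCT hJ
  have hub : dist b' (LatticeModels.meshPoint δ u + τ) ≤ δ := by
    have : dist (b' - τ) (LatticeModels.meshPoint δ u) ≤ δ := by
      rw [dist_comm]; exact LatticeModels.dist_meshPoint_nearestSite_le hδ _
    rwa [dist_eq_norm, show b' - τ - LatticeModels.meshPoint δ u = b' - (LatticeModels.meshPoint δ u + τ) by ring,
      ← dist_eq_norm] at this
  obtain ⟨e₁, he₁, he₁b⟩ : ∃ e₁ ∈ (closure R.carrier)ᶜ, dist e₁ b' < δ := by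
    obtain ⟨e₁, he₁, hd⟩ := Metric.mem_closure_iff.1 (R.frontier_subset_closure_exterior hJ hb') δ hδ
    exact ⟨e₁, he₁, by rwa [dist_comm]⟩
  have he₁u : dist e₁ (LatticeModels.meshPoint δ u + τ) < ((L : ℝ) + 1) * δ := by
    have hL' : (1 : ℝ) ≤ L := by exact_mod_cast hL
    calc dist e₁ (LatticeModels.meshPoint δ u + τ) ≤ dist e₁ b' + dist b' (LatticeModels.meshPoint δ u + τ) := dist_triangle _ _ _
      _ < δ + δ := by linarith
      _ ≤ ((L : ℝ) + 1) * δ := by nlinarith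
  obtain ⟨e₂, he₂, he₂u⟩ : ∃ e₂ ∈ (closure R.carrier)ᶜ,
      3 * Real.sqrt 2 * L * δ < dist e₂ (LatticeModels.meshPoint δ u + τ) := by
    by_contra! h'
    exact hEb ((isBounded_iff_subset_closedBall (LatticeModels.meshPoint δ u + τ)).2 ⟨_, fun z hz => h' z hz⟩)
  obtain ⟨z, hzE, hzW⟩ := henc.inter_image_meshTrace_nonempty hδ τ hs hEc.isPreconnected he₁
    he₁u he₂ he₂u
  -- so some dual edge of `W` has its planar dual edge not inside `Ω`
  set good : Sym2 (LatticeModels.Site 2) → Prop := fun e => dualScale δ '' edgeTrace e ⊆ R.carrier with hgood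
  obtain ⟨e₀, he₀, hbad₀⟩ : ∃ e₀ ∈ W.edges, ¬ good e₀ := by
    obtain ⟨y, hy, rfl⟩ := hzW
    obtain ⟨e₀, he₀, hye₀⟩ := mem_meshTrace_iff.1 hy
    refine ⟨e₀, he₀, fun hg => hzE (subset_closure (hg ?_))⟩
    rw [image_dualScale]
    exact mem_image_of_mem _ hye₀
  -- follow `W` from `j` to the first bad edge
  have hedges : ∀ e, e ∈ (W.rotate j hjW).edges ↔ e ∈ W.edges := fun e =>
    (W.rotate_edges j hjW).mem_iff
  obtain ⟨x, y, W₁, hxy, hmem, hbad, hsub, hgoodW₁, hsupp, hyW⟩ :=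
    exists_prefix_of_not_good good (W.rotate j hjW) ⟨e₀, (hedges e₀).2 he₀, hbad₀⟩
  have hsuppW : ∀ z ∈ W₁.support, z ∈ W.support := fun z hz =>
    (W.mem_support_rotate_iff j hjW).1 (hsupp z hz)
  have hyW' : y ∈ W.support := (W.mem_support_rotate_iff j hjW).1 hyW
  -- distances to `b'`
  have hnear : ∀ z ∈ W.support, dist (dualScale δ (LatticeModels.Site.toComplex z)) b' ≤
      3 * Real.sqrt 2 * L * δ + δ := by
    intro z hz
    have h1 : dist (LatticeModels.meshPoint δ z) (LatticeModels.meshPoint δ u) ≤ 3 * Real.sqrt 2 * L * δ :=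
      dist_meshPoint_le_of_mem_support hδ hWc.not_nil hs hz
    have h2 : dist (LatticeModels.meshPoint δ z + τ) (LatticeModels.meshPoint δ u + τ) = dist (LatticeModels.meshPoint δ z) (LatticeModels.meshPoint δ u) := by
      rw [dist_eq_norm, dist_eq_norm, add_sub_add_right_eq_sub]
    rw [dualScale_toComplex]
    linarith [dist_triangle (LatticeModels.meshPoint δ z + τ) (LatticeModels.meshPoint δ u + τ) b', dist_comm b' (LatticeModels.meshPoint δ u + τ)]
  -- the start `x` of the bad edge is inside `Ω`
  have hxΩ : dualScale δ (LatticeModels.Site.toComplex x) ∈ R.carrier := by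
    by_cases hn : W₁.Nil
    · -- `x = j`, a vertex of `D`
      have hjx : j = x := hn.eq
      subst hjx
      obtain ⟨e, he, hje⟩ := hjD
      refine hDΩ e he (mem_image_of_mem _ ?_)
      induction e using Sym2.ind with
      | h a b =>
        rcases Sym2.mem_iff.1 hje with rfl | rfl
        · exact toComplex_mem_edgeTrace_left _ _
        · exact toComplex_mem_edgeTrace_right _ _
    · obtain ⟨e, he, hxe⟩ :=
        (SimpleGraph.Walk.mem_support_iff_exists_mem_edges_of_not_nil hn).1 W₁.end_mem_support
      refine hgoodW₁ e he (mem_image_of_mem _ ?_)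
      induction e using Sym2.ind with
      | h a b =>
        rcases Sym2.mem_iff.1 hxe with rfl | rfl
        · exact toComplex_mem_edgeTrace_left _ _
        · exact toComplex_mem_edgeTrace_right _ _
  -- first exit along the bad planar dual edge
  have hseg : ¬ segment ℝ (dualScale δ (LatticeModels.Site.toComplex x)) (dualScale δ (LatticeModels.Site.toComplex y)) ⊆
      R.carrier := by
    rwa [← image_dualScale_edgeTrace]
  obtain ⟨t, ht0, ht1, hfr, hfΩ, hbefore⟩ := exists_first_exit R.isOpen hxΩ hseg
  exact ⟨j, x, y, W₁, t, _, hjD, hxy, hopen _ ((hedges _).1 hmem),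
    fun e he => hopen e ((hedges e).1 (hsub e he)), hgoodW₁, hbad,
    fun z hz => hnear z (hsuppW z hz), hnear y hyW', ht0, ht1, rfl, hfr, hfΩ, hbefore⟩

/-! ### Sub-segments -/

/-- Points of the initial piece `[a, a + t (b - a)]` of a segment, parametrised. [folklore] -/
theorem exists_param_of_mem_subsegment {a b z : ℂ} {t : ℝ}
    (hz : z ∈ segment ℝ a (a + t • (b - a))) : ∃ θ ∈ Icc (0 : ℝ) 1, z = a + (θ * t) • (b - a) := by
  rw [segment_eq_image'] at hz
  obtain ⟨θ, hθ, rfl⟩ := hz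
  exact ⟨θ, hθ, by dsimp only; rw [add_sub_cancel_left, smul_smul]⟩

/-- The initial piece `[a, a + t (b - a)]`, `t ∈ [0, 1]`, lies in the segment `[a, b]`. [folklore] -/
theorem subsegment_subset {a b : ℂ} {t : ℝ} (ht0 : 0 ≤ t) (ht1 : t ≤ 1) :
    segment ℝ a (a + t • (b - a)) ⊆ segment ℝ a b := by
  refine (convex_segment a b).segment_subset (left_mem_segment ℝ a b) ?_
  rw [segment_eq_image']
  exact ⟨t, ⟨ht0, ht1⟩, rfl⟩

/-- If `b` itself lies on the initial piece `[a, a + t (b - a)]` (`a ≠ b`, `0 < t ≤ 1`) then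
`t = 1`. [folklore] -/
theorem eq_one_of_mem_subsegment {a b : ℂ} (hab : a ≠ b) {t : ℝ} (ht0 : 0 < t) (ht1 : t ≤ 1)
    (h : b ∈ segment ℝ a (a + t • (b - a))) : t = 1 := by
  obtain ⟨θ, hθ, hb⟩ := exists_param_of_mem_subsegment h
  have hb' : (1 - θ * t) • (b - a) = 0 := by
    rw [sub_smul, one_smul, sub_eq_zero]
    nth_rw 1 [hb]
    rw [add_sub_cancel_left]
  rw [smul_eq_zero] at hb'
  rcases hb' with h1 | h1
  · nlinarith [hθ.1, hθ.2]
  · exact absurd (sub_eq_zero.1 h1).symm hab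

/-! ### Parameters of points of the arcs of a conformal rectangle -/

/-- For a conformal rectangle the arc `(bc) = arc 1` has parameter interval `[mark 1, mark 2]`.
[folklore] -/
theorem _root_.Literature.Probability.RandomPlanarGeometry.MarkedDomain.nextMark_one (R : RandomPlanarGeometry.ConformalRectangle) : R.nextMark 1 = R.mark 2 := by
  simp [RandomPlanarGeometry.MarkedDomain.nextMark]

/-- For a conformal rectangle the arc `(da) = arc 3` has parameter interval
`[mark 3, mark 0 + 1]`. [folklore] -/
theorem _root_.Literature.Probability.RandomPlanarGeometry.MarkedDomain.nextMark_three (R : RandomPlanarGeometry.ConformalRectangle) :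
    R.nextMark 3 = R.mark 0 + 1 := by
  simp [RandomPlanarGeometry.MarkedDomain.nextMark]

/-- A point of `arc 1` off the arcs `arc 0`, `arc 2` is `boundary s` with
`mark 1 < s < mark 2`. [folklore] -/
theorem exists_mem_Ioo_of_mem_arc_one (R : RandomPlanarGeometry.ConformalRectangle) {f : ℂ} (hf : f ∈ R.arc 1)
    (h0 : f ∉ R.arc 0) (h2 : f ∉ R.arc 2) : ∃ s ∈ Ioo (R.mark 1) (R.mark 2), f = R.boundary s := by
  obtain ⟨s, hs, rfl⟩ := hf
  rw [R.nextMark_one] at hs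
  refine ⟨s, ⟨hs.1.lt_of_ne ?_, hs.2.lt_of_ne ?_⟩, rfl⟩
  · rintro rfl
    have := R.pt_succ_mem_arc 0
    exact h0 (by simpa [RandomPlanarGeometry.MarkedDomain.pt] using this)
  · rintro h
    rw [h] at h2
    exact h2 (R.pt_mem_arc_self 2)

/-- A point of `arc 3` off the arcs `arc 2`, `arc 0` is `boundary t` with
`mark 3 < t < mark 0 + 1`. [folklore] -/
theorem exists_mem_Ioo_of_mem_arc_three (R : RandomPlanarGeometry.ConformalRectangle) {f : ℂ} (hf : f ∈ R.arc 3)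
    (h2 : f ∉ R.arc 2) (h0 : f ∉ R.arc 0) :
    ∃ t ∈ Ioo (R.mark 3) (R.mark 0 + 1), f = R.boundary t := by
  obtain ⟨t, ht, rfl⟩ := hf
  rw [R.nextMark_three] at ht
  refine ⟨t, ⟨ht.1.lt_of_ne ?_, ht.2.lt_of_ne ?_⟩, rfl⟩
  · rintro rfl
    have := R.pt_succ_mem_arc 2
    exact h2 (by simpa [RandomPlanarGeometry.MarkedDomain.pt] using this)
  · rintro h
    rw [h, R.periodic_boundary] at h0
    exact h0 (R.pt_mem_arc_self 0)

/-! ### The trace of a good dual path meets an exit segment only at its start -/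

/-- If `f = P x + t (P y - P x)` (`0 < t ≤ 1`, `P = dualScale δ`) is a point outside `Ω` on
the planar dual edge of the lattice edge `{x, y}`, then the sub-segment `[P x, f]` meets the
planar dual trace of any lattice walk all of whose planar dual edges lie in `Ω` at most in the
point `P x`. [folklore] -/
theorem segment_inter_image_walkTrace_subset {δ : ℝ} (hδ : 0 < δ) {Ω : Set ℂ} {x y : LatticeModels.Site 2}
    (hxy : (LatticeModels.zdGraph 2).Adj x y) {t : ℝ} (ht0 : 0 < t) (ht1 : t ≤ 1) {f : ℂ}
    (hf : f = dualScale δ (LatticeModels.Site.toComplex x) +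
      t • (dualScale δ (LatticeModels.Site.toComplex y) - dualScale δ (LatticeModels.Site.toComplex x)))
    (hfΩ : f ∉ Ω) {a b : LatticeModels.Site 2} {Q : (LatticeModels.zdGraph 2).Walk a b}
    (hgood : ∀ e ∈ Q.edges, dualScale δ '' edgeTrace e ⊆ Ω) :
    segment ℝ (dualScale δ (LatticeModels.Site.toComplex x)) f ∩ dualScale δ '' walkTrace Q ⊆
      {dualScale δ (LatticeModels.Site.toComplex x)} := by
  rintro z ⟨hz, hz'⟩
  rw [mem_singleton_iff]
  have hsub : segment ℝ (dualScale δ (LatticeModels.Site.toComplex x)) f ⊆ dualScale δ '' edgeTrace s(x, y) := by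
    rw [image_dualScale_edgeTrace, hf]; exact subsegment_subset ht0.le ht1
  obtain ⟨z₁, hz₁, rfl⟩ := hsub hz
  obtain ⟨z₂, hz₂, hz₁₂⟩ := hz'
  obtain rfl : z₂ = z₁ := dualScale_injective hδ.ne' hz₁₂
  obtain ⟨e', he', hze'⟩ := mem_walkTrace_iff.1 hz₂
  have hfmem : f ∈ dualScale δ '' edgeTrace s(x, y) := by
    rw [image_dualScale_edgeTrace, hf, segment_eq_image']
    exact ⟨t, ⟨ht0.le, ht1⟩, rfl⟩
  have hne : s(x, y) ≠ e' := by
    rintro rfl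
    exact hfΩ (hgood _ he' hfmem)
  obtain ⟨x', rfl, hx', hx'e⟩ := exists_eq_toComplex_of_mem_edgeTrace_inter hxy
    (Q.edges_subset_edgeSet he') hne hz₁ hze'
  rcases Sym2.mem_iff.1 hx' with rfl | rfl
  · rfl
  · -- `z = P y` on `[P x, f]` forces `t = 1`, `f = P y ∈ Ω`: contradiction
    exfalso
    have hPxy : dualScale δ (LatticeModels.Site.toComplex x) ≠ dualScale δ (LatticeModels.Site.toComplex x') := fun h =>
      hxy.ne (funext fun k => by
      simpa using congrArg (fun z => coordVec z k) (dualScale_injective hδ.ne' h))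
    have ht : t = 1 := eq_one_of_mem_subsegment hPxy ht0 ht1 (hf ▸ hz)
    rw [ht, one_smul, add_sub_cancel] at hf
    apply hfΩ
    rw [hf]
    refine hgood e' he' (mem_image_of_mem _ ?_)
    revert hx'e
    induction e' using Sym2.ind with
    | h a b =>
      intro hx'e
      rcases Sym2.mem_iff.1 hx'e with rfl | rfl
      · exact toComplex_mem_edgeTrace_left _ _
      · exact toComplex_mem_edgeTrace_right _ _

/-- Points of the exit segment `[P x, f]` other than `f` lie in `Ω` (they come before the first
exit). [folklore] -/
theorem mem_of_mem_segment_of_ne {δ : ℝ} {Ω : Set ℂ} {x y : LatticeModels.Site 2} {t : ℝ} (ht0 : 0 < t)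
    {f : ℂ} (hf : f = dualScale δ (LatticeModels.Site.toComplex x) +
      t • (dualScale δ (LatticeModels.Site.toComplex y) - dualScale δ (LatticeModels.Site.toComplex x)))
    (hbefore : ∀ s : ℝ, 0 ≤ s → s < t → dualScale δ (LatticeModels.Site.toComplex x) +
      s • (dualScale δ (LatticeModels.Site.toComplex y) - dualScale δ (LatticeModels.Site.toComplex x)) ∈ Ω)
    {z : ℂ} (hz : z ∈ segment ℝ (dualScale δ (LatticeModels.Site.toComplex x)) f) (hzf : z ≠ f) : z ∈ Ω := by
  rw [hf] at hz
  obtain ⟨θ, hθ, rfl⟩ := exists_param_of_mem_subsegment hz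
  refine hbefore _ (mul_nonneg hθ.1 ht0.le) ?_
  rcases hθ.2.eq_or_lt with rfl | hθ1
  · exact absurd (by rw [hf, one_mul]) hzf
  · nlinarith

/-- Points of the exit segment `[P x, f]` are within `δ` of `P x` (`δ ≥ 0`, `x ∼ y`). [folklore] -/
theorem dist_le_of_mem_exit_segment {δ : ℝ} (hδ : 0 ≤ δ) {x y : LatticeModels.Site 2} (hxy : (LatticeModels.zdGraph 2).Adj x y)
    {t : ℝ} (ht0 : 0 ≤ t) (ht1 : t ≤ 1) {f : ℂ}
    (hf : f = dualScale δ (LatticeModels.Site.toComplex x) +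
      t • (dualScale δ (LatticeModels.Site.toComplex y) - dualScale δ (LatticeModels.Site.toComplex x)))
    {z : ℂ} (hz : z ∈ segment ℝ (dualScale δ (LatticeModels.Site.toComplex x)) f) :
    dist z (dualScale δ (LatticeModels.Site.toComplex x)) ≤ δ := by
  refine dist_le_of_mem_image_dualScale_edgeTrace hδ hxy ?_
  rw [image_dualScale_edgeTrace]
  rw [hf] at hz
  exact subsegment_subset ht0 ht1 hz

/-! ### The dual cross-cut -/

/-- **The dual cross-cut** (deterministic heart of the RSW upper bound; Grimmett 2018, §5.7 /
Ex. 5.6; Bollobás–Riordan 2006, Ch. 7 §2 for the triangular lattice). In a conformal rectangle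
`R`, fix boundary points `b'` inside `arc 1` and `d'` inside `arc 3` with isolating radius `r`
and chain points `c 0, …, c N` of `Ω` from near `b'` to near `d'` (as in `exists_chainData`).
At a mesh `δ ≤ w / 200` with scales `m ≈ w / (40 δ)`, `L ≈ r / (20 δ)`: if the *dual*
configuration `dualConfig ω` has open circuits of `A(2m)` around the dual vertices nearest to
the `c k - δ(½, ½)`, open long-way crossings of the `20m × m` rectangles between them, and open
circuits of `A(L)` around the dual vertices nearest to `b' - δ(½, ½)` and `d' - δ(½, ½)`, then
there is a cross-cut `Λ` of `Ω` from a point `boundary s` strictly inside `arc 1` to a point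
`boundary t` strictly inside `arc 3`, every point of which lies on the planar dual edge
`δ (e* + (½, ½))` of some dual-open edge `e*`, and which stays either within
`3√2 L δ + 2δ` of `b'` or of `d'`, or at distance `≥ w/2` from `Ωᶜ`.
[cite: Grimmett2018, §5.7 p. 176 and Exercise 5.6 p. 186] -/
theorem exists_dual_crosscut (hJ : Literature.Topology.PlaneTopology.JordanCurveTheorem) (R : RandomPlanarGeometry.ConformalRectangle)
    {b' d' : ℂ} {r w : ℝ} {N : ℕ} {c : ℕ → ℂ} (hwr : w ≤ r / 40)
    (hb' : b' ∈ frontier R.carrier) (hd' : d' ∈ frontier R.carrier)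
    (hrb : ∀ z ∈ frontier R.carrier, dist z b' < r → z ∈ R.arc 1)
    (hrb' : ∀ j, j ≠ 1 → ∀ z ∈ R.arc j, r ≤ dist z b')
    (hrd : ∀ z ∈ frontier R.carrier, dist z d' < r → z ∈ R.arc 3)
    (hrd' : ∀ j, j ≠ 3 → ∀ z ∈ R.arc j, r ≤ dist z d')
    (hbd : 10 * r ≤ dist b' d') (hc0 : dist (c 0) b' < r / 40) (hcN : dist (c N) d' < r / 40)
    (hstep : ∀ k < N, dist (c k) (c (k + 1)) ≤ w / 100)
    (hball : ∀ k ≤ N, closedBall (c k) w ⊆ R.carrier)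
    {δ : ℝ} (hδ : 0 < δ) (hδw : δ ≤ w / 200)
    {m L : ℕ} (hm : 1 ≤ m) (hmw : (m : ℝ) * δ ≤ w / 40) (hmw' : w / 100 + 2 * δ ≤ m * δ)
    (hL : 1 ≤ L) (hLr : (L : ℝ) * δ ≤ r / 20) (hLr' : r / 20 < (L + 1) * δ)
    {ω : BondConfig (LatticeModels.Site 2)}
    (hA₁ : ∀ k ≤ N, dualConfig ω ∈
      openCircuitAroundAt (LatticeModels.nearestSite δ (c k - (δ : ℂ) * dualOffset)) (2 * m))
    (hA₂ : ∀ k < N, dualConfig ω ∈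
      lrCrossingAt (LatticeModels.nearestSite δ (c k - (δ : ℂ) * dualOffset) - ![(10 * m : ℤ), 0]) (20 * m) m)
    (hA₃ : dualConfig ω ∈ openCircuitAroundAt (LatticeModels.nearestSite δ (b' - (δ : ℂ) * dualOffset)) L)
    (hA₄ : dualConfig ω ∈ openCircuitAroundAt (LatticeModels.nearestSite δ (d' - (δ : ℂ) * dualOffset)) L) :
    ∃ (Λ : Set ℂ) (s t : ℝ), s ∈ Ioo (R.mark 1) (R.mark 2) ∧ t ∈ Ioo (R.mark 3) (R.mark 0 + 1) ∧
      R.IsCrosscut Λ (R.boundary s) (R.boundary t) ∧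
      (∀ z ∈ Λ, ∃ e ∈ dualConfig ω, z ∈ dualScale δ '' edgeTrace e) ∧
      (∀ z ∈ Λ, dist z b' ≤ 3 * Real.sqrt 2 * L * δ + 2 * δ ∨
        dist z d' ≤ 3 * Real.sqrt 2 * L * δ + 2 * δ ∨ ball z (w / 2) ⊆ R.carrier) := by
  set τ : ℂ := (δ : ℂ) * dualOffset with hτ
  set v : ℕ → LatticeModels.Site 2 := fun k => LatticeModels.nearestSite δ (c k - τ) with hv
  have hω' : dualConfig ω ⊆ (LatticeModels.zdGraph 2).edgeSet := dualConfig_subset_edgeSet ω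
  -- the dual chain cluster
  have hvstep : ∀ k < N, |v (k + 1) 0 - v k 0| ≤ m ∧ |v (k + 1) 1 - v k 1| ≤ m := by
    intro k hk
    have h : dist (c (k + 1) - τ) (c k - τ) + 2 * δ ≤ m * δ := by
      rw [dist_sub_right, dist_comm]; linarith [hstep k hk]
    exact ⟨abs_nearestSite_sub_le hδ h 0, abs_nearestSite_sub_le hδ h 1⟩
  obtain ⟨D, hD⟩ := exists_chainCluster hω' hm v N hvstep hA₁ hA₂
  -- its planar dual trace lies deep inside `Ω`
  have hnear : ∀ z ∈ ⋃ e ∈ D, edgeTrace e, ∃ k ≤ N, dist (dualScale δ z) (c k) ≤ 11 * (m * δ) + δ := by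
    intro z hz
    obtain ⟨e, he, hze⟩ := mem_iUnion₂.1 hz
    obtain ⟨k, hk, hek⟩ := hD.near e he
    refine ⟨k, hk, ?_⟩
    have h1 : dist (meshScale δ z) (LatticeModels.meshPoint δ (v k)) ≤ 11 * (m * δ) := by
      rw [dist_meshScale_meshPoint hδ.le]
      have := hek z hze
      nlinarith
    have h2 : dist (LatticeModels.meshPoint δ (v k)) (c k - τ) ≤ δ := LatticeModels.dist_meshPoint_nearestSite_le hδ _
    have h3 : dist (dualScale δ z) (c k) = dist (meshScale δ z) (c k - τ) := by
      rw [dualScale_eq_meshScale_add, dist_eq_norm, dist_eq_norm]; congr 1; ring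
    rw [h3]
    linarith [dist_triangle (meshScale δ z) (LatticeModels.meshPoint δ (v k)) (c k - τ)]
  have hdeep : ∀ z ∈ ⋃ e ∈ D, edgeTrace e, ball (dualScale δ z) (w / 2) ⊆ R.carrier := by
    intro z hz y hy
    obtain ⟨k, hk, hd⟩ := hnear z hz
    refine hball k hk (mem_closedBall.2 ?_)
    rw [mem_ball] at hy
    linarith [dist_triangle y (dualScale δ z) (c k)]
  have hDΩ : ∀ e ∈ D, dualScale δ '' edgeTrace e ⊆ R.carrier := by
    rintro e he _ ⟨z, hz, rfl⟩
    exact hdeep z (mem_biUnion he hz) (mem_ball_self (by linarith))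
  -- the two end circuits of the chain and the distance bookkeeping
  obtain ⟨a₀, w₀, hc₀, hs₀, -, hD₀⟩ := hD.first
  obtain ⟨a₁, w₁, hc₁, hs₁, -, hD₁⟩ := hD.last
  have hp : LatticeModels.Site.toComplex a₀ ∈ ⋃ e ∈ D, edgeTrace e :=
    walkTrace_subset_biUnion hD₀ (toComplex_start_mem_walkTrace hc₀.not_nil)
  have hq : LatticeModels.Site.toComplex a₁ ∈ ⋃ e ∈ D, edgeTrace e :=
    walkTrace_subset_biUnion hD₁ (toComplex_start_mem_walkTrace hc₁.not_nil)
  have hd₀ : dist (LatticeModels.meshPoint δ a₀) (c 0 - τ) ≤ 9 * (m * δ) + δ := by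
    have h1 : dist (LatticeModels.meshPoint δ a₀) (LatticeModels.meshPoint δ (v 0)) ≤ 3 * Real.sqrt 2 * ((2 * m : ℕ) : ℝ) * δ :=
      dist_meshPoint_le_of_mem_support hδ hc₀.not_nil hs₀ w₀.start_mem_support
    have h2 : dist (LatticeModels.meshPoint δ (v 0)) (c 0 - τ) ≤ δ := LatticeModels.dist_meshPoint_nearestSite_le hδ _
    linarith [dist_triangle (LatticeModels.meshPoint δ a₀) (LatticeModels.meshPoint δ (v 0)) (c 0 - τ),
      three_sqrt_two_two_mul_le (m := m) hδ.le]
  have hd₁ : dist (LatticeModels.meshPoint δ a₁) (c N - τ) ≤ 9 * (m * δ) + δ := by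
    have h1 : dist (LatticeModels.meshPoint δ a₁) (LatticeModels.meshPoint δ (v N)) ≤ 3 * Real.sqrt 2 * ((2 * m : ℕ) : ℝ) * δ :=
      dist_meshPoint_le_of_mem_support hδ hc₁.not_nil hs₁ w₁.start_mem_support
    have h2 : dist (LatticeModels.meshPoint δ (v N)) (c N - τ) ≤ δ := LatticeModels.dist_meshPoint_nearestSite_le hδ _
    linarith [dist_triangle (LatticeModels.meshPoint δ a₁) (LatticeModels.meshPoint δ (v N)) (c N - τ),
      three_sqrt_two_two_mul_le (m := m) hδ.le]
  have hd₀b : dist (LatticeModels.meshPoint δ a₀) (b' - τ) < r / 20 - δ := by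
    have := dist_triangle (LatticeModels.meshPoint δ a₀) (c 0 - τ) (b' - τ)
    rw [dist_sub_right (c 0)] at this
    linarith
  have hd₁d : dist (LatticeModels.meshPoint δ a₁) (d' - τ) < r / 20 - δ := by
    have := dist_triangle (LatticeModels.meshPoint δ a₁) (c N - τ) (d' - τ)
    rw [dist_sub_right (c N)] at this
    linarith
  have hub : dist (b' - τ) (LatticeModels.meshPoint δ (LatticeModels.nearestSite δ (b' - τ))) ≤ δ := by
    rw [dist_comm]; exact LatticeModels.dist_meshPoint_nearestSite_le hδ _
  have hud : dist (d' - τ) (LatticeModels.meshPoint δ (LatticeModels.nearestSite δ (d' - τ))) ≤ δ := by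
    rw [dist_comm]; exact LatticeModels.dist_meshPoint_nearestSite_le hδ _
  have hbdτ : dist (b' - τ) (d' - τ) = dist b' d' := dist_sub_right _ _ _
  have hL3 := three_sqrt_two_mul_le hδ.le hLr
  have hr0 : 0 < r := by
    have := dist_nonneg (x := c 0) (y := b')
    linarith
  have hLr3 : 3 * Real.sqrt 2 * L * δ + 3 * δ < r := by linarith
  -- the two exits
  obtain ⟨jb, xb, yb, Wb, tb, fb, hjb, hxyb, hob, hWbo, hWbg, hbadb, hWbn, hybn, htb0, htb1,
      hfb, hfbfr, hfbΩ, hbeforeb⟩ :=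
    exists_dual_exit hJ R.toJordanDomain hb' hδ hL hA₃ hD.mem_edgeSet hD.isPreconnected hDΩ hp hq
      (by
        rw [← meshPoint_eq_meshScale]
        linarith [dist_triangle (LatticeModels.meshPoint δ a₀) (b' - τ) (LatticeModels.meshPoint δ (LatticeModels.nearestSite δ (b' - τ)))])
      (by
        rw [← meshPoint_eq_meshScale]
        linarith [dist_triangle (b' - τ) (LatticeModels.meshPoint δ (LatticeModels.nearestSite δ (b' - τ))) (d' - τ),
          dist_triangle_left (LatticeModels.meshPoint δ (LatticeModels.nearestSite δ (b' - τ))) (d' - τ) (LatticeModels.meshPoint δ a₁)])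
  obtain ⟨jd, xd, yd, Wd, td, fd, hjd, hxyd, hod, hWdo, hWdg, hbadd, hWdn, hydn, htd0, htd1,
      hfd, hfdfr, hfdΩ, hbefored⟩ :=
    exists_dual_exit hJ R.toJordanDomain hd' hδ hL hA₄ hD.mem_edgeSet hD.isPreconnected hDΩ hq hp
      (by
        rw [← meshPoint_eq_meshScale]
        linarith [dist_triangle (LatticeModels.meshPoint δ a₁) (d' - τ) (LatticeModels.meshPoint δ (LatticeModels.nearestSite δ (d' - τ)))])
      (by
        rw [← meshPoint_eq_meshScale]
        linarith [dist_triangle (b' - τ) (LatticeModels.meshPoint δ a₀) (d' - τ), dist_comm (LatticeModels.meshPoint δ a₀) (b' - τ),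
          dist_triangle (LatticeModels.meshPoint δ a₀) (LatticeModels.meshPoint δ (LatticeModels.nearestSite δ (d' - τ))) (d' - τ),
          dist_comm (d' - τ) (LatticeModels.meshPoint δ (LatticeModels.nearestSite δ (d' - τ)))])
  -- notation for the planar points
  set P : ℂ → ℂ := fun z => dualScale δ z with hP
  set Pxb := dualScale δ (LatticeModels.Site.toComplex xb) with hPxb
  set Pxd := dualScale δ (LatticeModels.Site.toComplex xd) with hPxd
  -- the exit points are on the right arcs
  have hfbx : dist fb Pxb ≤ δ :=
    dist_le_of_mem_exit_segment hδ.le hxyb htb0.le htb1 hfb (right_mem_segment _ _ _)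
  have hfdx : dist fd Pxd ≤ δ :=
    dist_le_of_mem_exit_segment hδ.le hxyd htd0.le htd1 hfd (right_mem_segment _ _ _)
  have hxbn : dist Pxb b' ≤ 3 * Real.sqrt 2 * L * δ + δ := hWbn xb Wb.end_mem_support
  have hxdn : dist Pxd d' ≤ 3 * Real.sqrt 2 * L * δ + δ := hWdn xd Wd.end_mem_support
  have hfbb : dist fb b' < r := by linarith [dist_triangle fb Pxb b']
  have hfdd : dist fd d' < r := by linarith [dist_triangle fd Pxd d']
  have hfb1 : fb ∈ R.arc 1 := hrb fb hfbfr hfbb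
  have hfd3 : fd ∈ R.arc 3 := hrd fd hfdfr hfdd
  have hfb_off : ∀ j, j ≠ 1 → fb ∉ R.arc j := fun j hj h => by
    have := hrb' j hj fb h; linarith
  have hfd_off : ∀ j, j ≠ 3 → fd ∉ R.arc j := fun j hj h => by
    have := hrd' j hj fd h; linarith
  obtain ⟨sb, hsb, hfbs⟩ := exists_mem_Ioo_of_mem_arc_one R hfb1 (hfb_off 0 (by decide))
    (hfb_off 2 (by decide))
  obtain ⟨td', htd', hfdt⟩ := exists_mem_Ioo_of_mem_arc_three R hfd3 (hfd_off 2 (by decide))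
    (hfd_off 0 (by decide))
  -- the dual path from `xb` to `xd`
  obtain ⟨Pw⟩ := hD.reachable jb hjb jd hjd
  have hPw : ∀ e ∈ Pw.edges, e ∈ D := fun e he => by
    have := Pw.edges_subset_edgeSet he
    rw [SimpleGraph.edgeSet_fromEdgeSet] at this
    exact this.1
  set Pth : (LatticeModels.zdGraph 2).Walk jb jd := Pw.transfer (LatticeModels.zdGraph 2) (fun e he => hD.mem_edgeSet e (hPw e he))
    with hPth
  have hPth_edges : ∀ e ∈ Pth.edges, e ∈ D := fun e he => by
    rw [hPth, SimpleGraph.Walk.edges_transfer] at he; exact hPw e he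
  set Q : (LatticeModels.zdGraph 2).Walk xb xd := Wb.reverse.append (Pth.append Wd) with hQ
  have hQe : ∀ e ∈ Q.edges, e ∈ Wb.edges ∨ e ∈ D ∨ e ∈ Wd.edges := by
    intro e he
    rw [hQ, SimpleGraph.Walk.edges_append, List.mem_append, SimpleGraph.Walk.edges_reverse,
      List.mem_reverse, SimpleGraph.Walk.edges_append, List.mem_append] at he
    rcases he with he | he | he
    · exact Or.inl he
    · exact Or.inr (Or.inl (hPth_edges e he))
    · exact Or.inr (Or.inr he)
  set Qp := Q.bypass with hQp
  have hQpe : ∀ e ∈ Qp.edges, e ∈ Wb.edges ∨ e ∈ D ∨ e ∈ Wd.edges := fun e he =>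
    hQe e (Q.edges_bypass_subset_edges he)
  have hQp_open : ∀ e ∈ Qp.edges, e ∈ dualConfig ω := by
    intro e he
    rcases hQpe e he with h | h | h
    · exact hWbo e h
    · exact hD.subset h
    · exact hWdo e h
  have hQp_good : ∀ e ∈ Qp.edges, dualScale δ '' edgeTrace e ⊆ R.carrier := by
    intro e he
    rcases hQpe e he with h | h | h
    · exact hWbg e h
    · exact hDΩ e h
    · exact hWdg e h
  -- `xb ≠ xd`: they are near `b'` and `d'` respectively
  have hρ : 2 * (3 * Real.sqrt 2 * L * δ + 2 * δ) < dist b' d' := by linarith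
  have hxbd : Pxb ≠ Pxd := by
    intro h
    have h1 : dist Pxd b' ≤ 3 * Real.sqrt 2 * L * δ + δ := h ▸ hxbn
    linarith [dist_triangle_left b' d' Pxd]
  have hQpn : ¬ Qp.Nil := by
    intro hn
    exact hxbd (by rw [hPxb, hPxd, hn.eq])
  -- the three arcs
  have hTarc : Literature.Topology.PlaneTopology.IsSimpleArc (dualScale δ '' walkTrace Qp) Pxb Pxd :=
    (isSimpleArc_walkTrace Q.bypass_isPath hQpn).image (continuous_dualScale δ)
      (dualScale_injective hδ.ne')
  have hPxy : ∀ {x y : LatticeModels.Site 2}, (LatticeModels.zdGraph 2).Adj x y →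
      dualScale δ (LatticeModels.Site.toComplex x) ≠ dualScale δ (LatticeModels.Site.toComplex y) := fun hxy h =>
    hxy.ne (funext fun k => by
      simpa using congrArg (fun z => coordVec z k) (dualScale_injective hδ.ne' h))
  have hBarc : Literature.Topology.PlaneTopology.IsSimpleArc (segment ℝ Pxb fb) fb Pxb := by
    have := Literature.Topology.PlaneTopology.IsSimpleArc.subsegment (hPxy hxyb) htb0
    rw [← hfb] at this
    exact this.symm
  have hCarc : Literature.Topology.PlaneTopology.IsSimpleArc (segment ℝ Pxd fd) Pxd fd := by
    have := Literature.Topology.PlaneTopology.IsSimpleArc.subsegment (hPxy hxyd) htd0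
    rw [← hfd] at this
    exact this
  -- gluing
  have h₁ : segment ℝ Pxb fb ∩ dualScale δ '' walkTrace Qp ⊆ {Pxb} :=
    segment_inter_image_walkTrace_subset hδ hxyb htb0 htb1 hfb hfbΩ hQp_good
  have h₂ : (segment ℝ Pxb fb ∪ dualScale δ '' walkTrace Qp) ∩ segment ℝ Pxd fd ⊆ {Pxd} := by
    rintro z ⟨hz | hz, hz'⟩
    · -- the two exit segments are far apart
      exfalso
      have h1 : dist z b' ≤ 3 * Real.sqrt 2 * L * δ + 2 * δ := by
        linarith [dist_le_of_mem_exit_segment hδ.le hxyb htb0.le htb1 hfb hz, dist_triangle z Pxb b']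
      have h2 : dist z d' ≤ 3 * Real.sqrt 2 * L * δ + 2 * δ := by
        linarith [dist_le_of_mem_exit_segment hδ.le hxyd htd0.le htd1 hfd hz', dist_triangle z Pxd d']
      linarith [dist_triangle_left b' d' z]
    · have := segment_inter_image_walkTrace_subset hδ hxyd htd0 htd1 hfd hfdΩ
        (Q := Qp.reverse) (fun e he => hQp_good e (by
          rwa [SimpleGraph.Walk.edges_reverse, List.mem_reverse] at he))
      refine this ⟨hz', ?_⟩
      rwa [show walkTrace Qp.reverse = walkTrace Qp by
        ext; simp only [mem_walkTrace_iff, SimpleGraph.Walk.edges_reverse, List.mem_reverse]]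
  have harc : Literature.Topology.PlaneTopology.IsSimpleArc ((segment ℝ Pxb fb ∪ dualScale δ '' walkTrace Qp) ∪ segment ℝ Pxd fd) fb fd :=
    (hBarc.union hTarc h₁).union hCarc h₂
  set Λ : Set ℂ := (segment ℝ Pxb fb ∪ dualScale δ '' walkTrace Qp) ∪ segment ℝ Pxd fd with hΛ
  -- classification of the points of `Λ`
  have hedge : ∀ z ∈ Λ, ∃ e ∈ dualConfig ω, z ∈ dualScale δ '' edgeTrace e := by
    rintro z ((hz | hz) | hz)
    · refine ⟨_, hob, ?_⟩
      rw [image_dualScale_edgeTrace]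
      rw [hfb] at hz
      exact subsegment_subset htb0.le htb1 hz
    · obtain ⟨z₀, hz₀, rfl⟩ := hz
      obtain ⟨e, he, hze⟩ := mem_walkTrace_iff.1 hz₀
      exact ⟨e, hQp_open e he, mem_image_of_mem _ hze⟩
    · refine ⟨_, hod, ?_⟩
      rw [image_dualScale_edgeTrace]
      rw [hfd] at hz
      exact subsegment_subset htd0.le htd1 hz
  have hwhere : ∀ z ∈ Λ, dist z b' ≤ 3 * Real.sqrt 2 * L * δ + 2 * δ ∨
      dist z d' ≤ 3 * Real.sqrt 2 * L * δ + 2 * δ ∨ ball z (w / 2) ⊆ R.carrier := by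
    rintro z ((hz | hz) | hz)
    · left
      linarith [dist_le_of_mem_exit_segment hδ.le hxyb htb0.le htb1 hfb hz, dist_triangle z Pxb b']
    · obtain ⟨z₀, hz₀, rfl⟩ := hz
      obtain ⟨e, he, hze⟩ := mem_walkTrace_iff.1 hz₀
      rcases hQpe e he with h | h | h
      · left
        obtain ⟨x', y', rfl⟩ : ∃ x' y', e = s(x', y') := by
          induction e using Sym2.ind with
          | h x y => exact ⟨x, y, rfl⟩
        have hx' := hWbn x' (Wb.fst_mem_support_of_mem_edges h)
        have hy' := hWbn y' (Wb.snd_mem_support_of_mem_edges h)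
        have hmem : dualScale δ z₀ ∈ segment ℝ (dualScale δ (LatticeModels.Site.toComplex x'))
            (dualScale δ (LatticeModels.Site.toComplex y')) := by
          rw [← image_dualScale_edgeTrace]; exact mem_image_of_mem _ hze
        have hsub := (convex_closedBall b' (3 * Real.sqrt 2 * L * δ + δ)).segment_subset
          (mem_closedBall.2 hx') (mem_closedBall.2 hy') hmem
        linarith [mem_closedBall.1 hsub]
      · exact Or.inr (Or.inr (hdeep z₀ (mem_biUnion h hze)))
      · right; left
        obtain ⟨x', y', rfl⟩ : ∃ x' y', e = s(x', y') := by
          induction e using Sym2.ind with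
          | h x y => exact ⟨x, y, rfl⟩
        have hx' := hWdn x' (Wd.fst_mem_support_of_mem_edges h)
        have hy' := hWdn y' (Wd.snd_mem_support_of_mem_edges h)
        have hmem : dualScale δ z₀ ∈ segment ℝ (dualScale δ (LatticeModels.Site.toComplex x'))
            (dualScale δ (LatticeModels.Site.toComplex y')) := by
          rw [← image_dualScale_edgeTrace]; exact mem_image_of_mem _ hze
        have hsub := (convex_closedBall d' (3 * Real.sqrt 2 * L * δ + δ)).segment_subset
          (mem_closedBall.2 hx') (mem_closedBall.2 hy') hmem
        linarith [mem_closedBall.1 hsub]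
    · right; left
      linarith [dist_le_of_mem_exit_segment hδ.le hxyd htd0.le htd1 hfd hz, dist_triangle z Pxd d']
  -- the cross-cut
  refine ⟨Λ, sb, td', hsb, htd', ⟨?_, ?_, ?_, ?_, ?_⟩, hedge, hwhere⟩
  · rw [← hfbs, ← hfdt]; exact harc
  · rw [← hfbs]; exact hfbfr
  · rw [← hfdt]; exact hfdfr
  · rw [← hfbs, ← hfdt]
    intro h
    have := hrb' 3 (by decide) fd hfd3
    rw [← h] at this
    linarith
  · rw [← hfbs, ← hfdt]
    rintro z ⟨((hz | hz) | hz), hzne⟩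
    · have hzf : z ≠ fb := fun h => hzne (Or.inl h)
      exact mem_of_mem_segment_of_ne htb0 hfb hbeforeb hz hzf
    · obtain ⟨z₀, hz₀, rfl⟩ := hz
      obtain ⟨e, he, hze⟩ := mem_walkTrace_iff.1 hz₀
      exact hQp_good e he (mem_image_of_mem _ hze)
    · have hzf : z ≠ fd := fun h => hzne (Or.inr h)
      exact mem_of_mem_segment_of_ne htd0 hfd hbefored hz hzf

/-! ### Exits of discrete boundary vertices -/

/-- **First frontier point along a boundary edge.** A discrete boundary vertex `x ∈ ∂Ω_δ` of an
open set `Ω` has a lattice neighbour `y` and a point `f ∈ ∂Ω` on the closed mesh edge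
`[δx, δy]` such that the initial piece `[δx, f]` lies in `Ω̄` (the first exit of the edge from
`Ω`). [folklore] -/
theorem exists_frontier_exit_of_mem_meshBoundary {Ω : Set ℂ} (hΩ : IsOpen Ω) {δ : ℝ} {x : LatticeModels.Site 2}
    (hx : x ∈ LatticeModels.meshBoundary Ω δ) :
    ∃ (y : LatticeModels.Site 2) (f : ℂ), (LatticeModels.zdGraph 2).Adj x y ∧ f ∈ frontier Ω ∧
      f ∈ segment ℝ (LatticeModels.meshPoint δ x) (LatticeModels.meshPoint δ y) ∧ segment ℝ (LatticeModels.meshPoint δ x) f ⊆ closure Ω := by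
  obtain ⟨y, hxy, w, hw, hwf⟩ := Literature.Probability.Percolation.exists_mem_frontier_of_mem_meshBoundary hΩ hx
  have hxΩ : LatticeModels.meshPoint δ x ∈ Ω := LatticeModels.meshDomain_subset_meshVertices Ω δ hx.1
  have hwΩ : w ∉ Ω := by
    rw [hΩ.frontier_eq] at hwf
    exact hwf.2
  have hseg : ¬ segment ℝ (LatticeModels.meshPoint δ x) (LatticeModels.meshPoint δ y) ⊆ Ω := fun h => hwΩ (h hw)
  obtain ⟨t, ht0, ht1, hfr, -, hbefore⟩ := exists_first_exit hΩ hxΩ hseg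
  refine ⟨y, _, hxy, hfr, ?_, ?_⟩
  · rw [segment_eq_image']
    exact ⟨t, ⟨ht0.le, ht1⟩, rfl⟩
  · intro z hz
    obtain ⟨θ, hθ, rfl⟩ := exists_param_of_mem_subsegment hz
    rcases hθ.2.eq_or_lt with rfl | hθ1
    · rw [one_mul]
      exact frontier_subset_closure hfr
    · exact subset_closure (hbefore _ (mul_nonneg hθ.1 ht0.le) (by nlinarith))

/-- Points of the initial piece `[δx, f]` of a mesh edge `[δx, δy]` are within `|δ|` of `δx`.
[folklore] -/
theorem dist_le_of_mem_segment_of_mem_segment {δ : ℝ} {x y : LatticeModels.Site 2} (hxy : (LatticeModels.zdGraph 2).Adj x y)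
    {f : ℂ} (hf : f ∈ segment ℝ (LatticeModels.meshPoint δ x) (LatticeModels.meshPoint δ y)) {z : ℂ}
    (hz : z ∈ segment ℝ (LatticeModels.meshPoint δ x) f) : dist z (LatticeModels.meshPoint δ x) ≤ |δ| := by
  have hsub : segment ℝ (LatticeModels.meshPoint δ x) (LatticeModels.meshPoint δ y) ⊆ closedBall (LatticeModels.meshPoint δ x) |δ| :=
    (convex_closedBall _ _).segment_subset (mem_closedBall_self (abs_nonneg δ))
      (by rw [mem_closedBall, dist_comm, Literature.Probability.Percolation.dist_meshPoint_of_adj hxy])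
  have hsub' : segment ℝ (LatticeModels.meshPoint δ x) f ⊆ closedBall (LatticeModels.meshPoint δ x) |δ| :=
    (convex_closedBall _ _).segment_subset (mem_closedBall_self (abs_nonneg δ)) (hsub hf)
  exact mem_closedBall.1 (hsub' hz)

/-! ### Walks of the discrete domain as lattice walks -/

/-- An open path of the discrete domain `Ω_δ` is a lattice walk all of whose edges are open and
whose mesh trace lies in `Ω̄`. [folklore] -/
theorem exists_walk_of_reachable_openGraph_inf {Ω : Set ℂ} {δ : ℝ} {ω : BondConfig (LatticeModels.Site 2)}
    {x y : LatticeModels.Site 2} (h : (openGraph ω ⊓ LatticeModels.discreteDomainGraph Ω δ).Reachable x y) :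
    ∃ π : (LatticeModels.zdGraph 2).Walk x y, (∀ e ∈ π.edges, e ∈ ω) ∧ meshTrace δ π ⊆ closure Ω := by
  obtain ⟨p⟩ := h
  have hle : openGraph ω ⊓ LatticeModels.discreteDomainGraph Ω δ ≤ LatticeModels.zdGraph 2 := fun a b hab =>
    LatticeModels.meshGraph_le_zdGraph Ω δ (LatticeModels.discreteDomainGraph_le_meshGraph Ω δ hab.2)
  refine ⟨p.mapLe hle, fun e he => ?_, fun z hz => ?_⟩
  · rw [SimpleGraph.Walk.edges_mapLe_eq_edges] at he
    have := p.edges_subset_edgeSet he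
    rw [SimpleGraph.edgeSet_inf] at this
    have h1 := this.1
    rw [openGraph, SimpleGraph.edgeSet_fromEdgeSet] at h1
    exact h1.1
  · obtain ⟨e, he, hze⟩ := mem_meshTrace_iff.1 hz
    rw [SimpleGraph.Walk.edges_mapLe_eq_edges] at he
    have hE := p.edges_subset_edgeSet he
    revert hze hE
    induction e using Sym2.ind with
    | h a b =>
      intro hze hE
      rw [SimpleGraph.mem_edgeSet] at hE
      have hadj : (LatticeModels.meshGraph Ω δ).Adj a b := LatticeModels.discreteDomainGraph_le_meshGraph Ω δ hE.2
      rw [← segment_meshPoint_eq_image] at hze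
      exact (LatticeModels.meshGraph_adj_iff.1 hadj).2 hze

/-! ### Parameter bookkeeping on the boundary loop of a conformal rectangle -/

/-- Uniform continuity of the boundary loop on `[0, 2]`, quantitative form: for `ρ > 0` there is
`η ∈ (0, 1)` with `dist (boundary u) (boundary v) < ρ` whenever `u, v ∈ [0, 2]`, `|u - v| ≤ η`.
[folklore] -/
theorem exists_forall_dist_boundary_lt (R : RandomPlanarGeometry.ConformalRectangle) {ρ : ℝ} (hρ : 0 < ρ) :
    ∃ η : ℝ, 0 < η ∧ η < 1 ∧ ∀ u ∈ Icc (0 : ℝ) 2, ∀ v ∈ Icc (0 : ℝ) 2, |u - v| ≤ η →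
      dist (R.boundary u) (R.boundary v) < ρ := by
  have huc : UniformContinuousOn R.boundary (Icc (0 : ℝ) 2) :=
    isCompact_Icc.uniformContinuousOn_of_continuous R.continuous_boundary.continuousOn
  obtain ⟨η, hη, h⟩ := Metric.uniformContinuousOn_iff.1 huc ρ hρ
  refine ⟨min (η / 2) (1 / 2), lt_min (by positivity) (by norm_num),
    (min_le_right _ _).trans_lt (by norm_num), fun u hu v hv huv => h u hu v hv ?_⟩
  rw [Real.dist_eq]
  exact huv.trans_lt ((min_le_left _ _).trans_lt (by linarith))

/-- Basic order facts for the marks of a conformal rectangle: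
`0 ≤ mark 0 < mark 1 < mark 2 < mark 3 < 1`. [folklore] -/
theorem mark_chain (R : RandomPlanarGeometry.ConformalRectangle) :
    0 ≤ R.mark 0 ∧ R.mark 0 < R.mark 1 ∧ R.mark 1 < R.mark 2 ∧ R.mark 2 < R.mark 3 ∧ R.mark 3 < 1 :=
  ⟨(R.mark_mem 0).1, R.strictMono_mark (by decide), R.strictMono_mark (by decide),
    R.strictMono_mark (by decide), (R.mark_mem 3).2⟩

/-- **The end-points of the dual cross-cut are a definite parameter distance inside their arcs.**
If `η` is a continuity modulus of the boundary loop at scale `r / 2` (as in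
`exists_forall_dist_boundary_lt`), the points `b'`, `d'` are at distance `≥ r` from the arcs
other than `arc 1`, `arc 3` respectively, and `boundary s` (`mark 1 < s < mark 2`) is within
`ρ < r / 2` of `b'`, `boundary t` (`mark 3 < t < mark 0 + 1`) within `ρ` of `d'`, then
`mark 1 + η < s < mark 2 - η` and `mark 3 + η < t < mark 0 + 1 - η`. [folklore] -/
theorem crosscut_param_bounds (R : RandomPlanarGeometry.ConformalRectangle) {b' d' : ℂ} {r ρ η : ℝ}
    (hrb' : ∀ j, j ≠ 1 → ∀ z ∈ R.arc j, r ≤ dist z b')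
    (hrd' : ∀ j, j ≠ 3 → ∀ z ∈ R.arc j, r ≤ dist z d') (hρ : ρ < r / 2)
    (hη : ∀ u ∈ Icc (0 : ℝ) 2, ∀ v ∈ Icc (0 : ℝ) 2, |u - v| ≤ η →
      dist (R.boundary u) (R.boundary v) < r / 2)
    {s t : ℝ} (hs : s ∈ Ioo (R.mark 1) (R.mark 2)) (ht : t ∈ Ioo (R.mark 3) (R.mark 0 + 1))
    (hsb : dist (R.boundary s) b' ≤ ρ) (htd : dist (R.boundary t) d' ≤ ρ) :
    R.mark 1 + η < s ∧ s < R.mark 2 - η ∧ R.mark 3 + η < t ∧ t < R.mark 0 + 1 - η := by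
  obtain ⟨h0, h01, h12, h23, h3⟩ := mark_chain R
  have hpt1 : r ≤ dist (R.pt 1) b' := hrb' 0 (by decide) _ (by
    have := R.pt_succ_mem_arc 0; rwa [show (0 : Fin 4) + 1 = 1 from rfl] at this)
  have hpt2 : r ≤ dist (R.pt 2) b' := hrb' 2 (by decide) _ (R.pt_mem_arc_self 2)
  have hpt3 : r ≤ dist (R.pt 3) d' := hrd' 2 (by decide) _ (by
    have := R.pt_succ_mem_arc 2; rwa [show (2 : Fin 4) + 1 = 3 from rfl] at this)
  have hpt0 : r ≤ dist (R.pt 0) d' := hrd' 0 (by decide) _ (R.pt_mem_arc_self 0)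
  have hsI : s ∈ Icc (0 : ℝ) 2 := ⟨by linarith [hs.1], by linarith [hs.2]⟩
  have htI : t ∈ Icc (0 : ℝ) 2 := ⟨by linarith [ht.1], by linarith [ht.2]⟩
  have hmI : ∀ i : Fin 4, R.mark i ∈ Icc (0 : ℝ) 2 := fun i =>
    ⟨(R.mark_mem i).1, by linarith [(R.mark_mem i).2]⟩
  refine ⟨?_, ?_, ?_, ?_⟩
  · by_contra hle
    push Not at hle
    have h := hη s hsI (R.mark 1) (hmI 1) (by rw [abs_le]; constructor <;> linarith [hs.1])
    change dist (R.boundary s) (R.pt 1) < r / 2 at h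
    linarith [dist_triangle (R.pt 1) (R.boundary s) b', dist_comm (R.pt 1) (R.boundary s)]
  · by_contra hle
    push Not at hle
    have h := hη s hsI (R.mark 2) (hmI 2) (by rw [abs_le]; constructor <;> linarith [hs.2])
    change dist (R.boundary s) (R.pt 2) < r / 2 at h
    linarith [dist_triangle (R.pt 2) (R.boundary s) b', dist_comm (R.pt 2) (R.boundary s)]
  · by_contra hle
    push Not at hle
    have h := hη t htI (R.mark 3) (hmI 3) (by rw [abs_le]; constructor <;> linarith [ht.1])
    change dist (R.boundary t) (R.pt 3) < r / 2 at h
    linarith [dist_triangle (R.pt 3) (R.boundary t) d', dist_comm (R.pt 3) (R.boundary t)]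
  · by_contra hle
    push Not at hle
    have h := hη t htI (R.mark 0 + 1) ⟨by linarith, by linarith [(R.mark_mem 0).2]⟩
      (by rw [abs_le]; constructor <;> linarith [ht.2])
    rw [R.periodic_boundary] at h
    change dist (R.boundary t) (R.pt 0) < r / 2 at h
    linarith [dist_triangle (R.pt 0) (R.boundary t) d', dist_comm (R.pt 0) (R.boundary t)]

/-- The boundary piece with parameters in `[mark 1 + η, mark 0 + 1 - η]` (`η > 0`) misses
`arc 0 = boundary '' [mark 0, mark 1]` (injectivity of the boundary loop on a period).
[folklore] -/
theorem disjoint_image_Icc_arc_zero (R : RandomPlanarGeometry.ConformalRectangle) {η : ℝ} (hη : 0 < η) :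
    Disjoint (R.boundary '' Icc (R.mark 1 + η) (R.mark 0 + 1 - η)) (R.arc 0) := by
  obtain ⟨h0, h01, h12, h23, h3⟩ := mark_chain R
  refine disjoint_left.2 ?_
  rintro _ ⟨u, hu, rfl⟩ ⟨v, hv, huv⟩
  rw [R.nextMark_zero] at hv
  have huI : u ∈ Ico (R.mark 0) (R.mark 0 + 1) := ⟨by linarith [hu.1], by linarith [hu.2]⟩
  have hvI : v ∈ Ico (R.mark 0) (R.mark 0 + 1) := ⟨hv.1, by linarith [hv.2]⟩
  have := R.injOn_boundary_Ico_mark_zero huI hvI huv.symm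
  subst this
  linarith [hu.1, hv.2]

/-- The boundary piece with parameters in `[mark 3 + η, mark 2 + 1 - η]` (`η > 0`) misses
`arc 2 = boundary '' [mark 2, mark 3]`. [folklore] -/
theorem disjoint_image_Icc_arc_two (R : RandomPlanarGeometry.ConformalRectangle) {η : ℝ} (hη : 0 < η) :
    Disjoint (R.boundary '' Icc (R.mark 3 + η) (R.mark 2 + 1 - η)) (R.arc 2) := by
  obtain ⟨h0, h01, h12, h23, h3⟩ := mark_chain R
  refine disjoint_left.2 ?_
  rintro _ ⟨u, hu, rfl⟩ ⟨v, hv, huv⟩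
  rw [R.nextMark_two] at hv
  have hvI : v ∈ Ico (R.mark 0) (R.mark 0 + 1) := ⟨by linarith [hv.1], by linarith [hv.2]⟩
  by_cases hu1 : u < R.mark 0 + 1
  · have huI : u ∈ Ico (R.mark 0) (R.mark 0 + 1) := ⟨by linarith [hu.1], hu1⟩
    have := R.injOn_boundary_Ico_mark_zero huI hvI huv.symm
    subst this
    linarith [hu.1, hv.2]
  · push Not at hu1
    have huI : u - 1 ∈ Ico (R.mark 0) (R.mark 0 + 1) := ⟨by linarith, by linarith [hu.2]⟩
    have hb : R.boundary (u - 1) = R.boundary u := by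
      have := R.periodic_boundary (u - 1); rw [sub_add_cancel] at this; exact this.symm
    have := R.injOn_boundary_Ico_mark_zero huI hvI (hb.trans huv.symm)
    linarith [hu.2, hv.1]

/-- **Frontier points near `arc 0` lie strictly inside the complementary arc of the cross-cut.**
If the boundary piece `boundary '' [mark 1 + η, mark 0 + 1 - η]` stays at `infDist > ε` from
`arc 0`, `mark 1 + η < s`, `t < mark 0 + 1 - η`, and `f ∈ ∂Ω` has `infDist f (arc 0) ≤ ε`,
then `f = boundary u` for some `u ∈ (t, s + 1)`. [folklore] -/
theorem exists_Ioo_of_infDist_arc_zero (R : RandomPlanarGeometry.ConformalRectangle) {η ε : ℝ}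
    (hfar : ∀ p ∈ R.boundary '' Icc (R.mark 1 + η) (R.mark 0 + 1 - η), ε < infDist p (R.arc 0))
    {s t : ℝ} (hs : R.mark 1 + η < s) (ht : t < R.mark 0 + 1 - η)
    {f : ℂ} (hf : f ∈ frontier R.carrier) (hfd : infDist f (R.arc 0) ≤ ε) :
    ∃ u ∈ Ioo t (s + 1), f = R.boundary u := by
  rw [← R.range_boundary] at hf
  obtain ⟨v, rfl⟩ := hf
  obtain ⟨u, hu, huv⟩ := R.periodic_boundary.exists_mem_Ico one_pos v s
  refine ⟨u, ⟨?_, hu.2⟩, huv⟩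
  by_contra hut
  push Not at hut
  have hmem : R.boundary v ∈ R.boundary '' Icc (R.mark 1 + η) (R.mark 0 + 1 - η) :=
    ⟨u, ⟨by linarith [hu.1], by linarith⟩, huv.symm⟩
  linarith [hfar _ hmem]

/-- **Frontier points near `arc 2` lie strictly inside the arc of the cross-cut containing
`arc 2`.** If the boundary piece `boundary '' [mark 3 + η, mark 2 + 1 - η]` stays at
`infDist > ε` from `arc 2`, `mark 1 + η < s < mark 2 - η`, `mark 3 + η < t`, and `f ∈ ∂Ω`
has `infDist f (arc 2) ≤ ε`, then `f = boundary u` for some `u ∈ (s, t)`. [folklore] -/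
theorem exists_Ioo_of_infDist_arc_two (R : RandomPlanarGeometry.ConformalRectangle) {η ε : ℝ}
    (hfar : ∀ p ∈ R.boundary '' Icc (R.mark 3 + η) (R.mark 2 + 1 - η), ε < infDist p (R.arc 2))
    {s t : ℝ} (hs1 : R.mark 1 + η < s) (hs : s < R.mark 2 - η) (ht : R.mark 3 + η < t)
    {f : ℂ} (hf : f ∈ frontier R.carrier) (hfd : infDist f (R.arc 2) ≤ ε) :
    ∃ u ∈ Ioo s t, f = R.boundary u := by
  obtain ⟨h0, h01, h12, h23, h3⟩ := mark_chain R
  rw [← R.range_boundary] at hf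
  obtain ⟨v, rfl⟩ := hf
  obtain ⟨u, hu, huv⟩ := R.periodic_boundary.exists_mem_Ico one_pos v t
  have hnot : ∀ u', R.boundary v = R.boundary u' →
      u' ∉ Icc (R.mark 3 + η) (R.mark 2 + 1 - η) := by
    intro u' hu' hmem
    have hmem' : R.boundary v ∈ R.boundary '' Icc (R.mark 3 + η) (R.mark 2 + 1 - η) :=
      ⟨u', hmem, hu'.symm⟩
    linarith [hfar _ hmem']
  by_cases hus : u < s + 1
  · exact absurd ⟨by linarith [hu.1], by linarith⟩ (hnot u huv)
  · push Not at hus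
    have hb : R.boundary (u - 1) = R.boundary u := by
      have := R.periodic_boundary (u - 1); rw [sub_add_cancel] at this; exact this.symm
    refine ⟨u - 1, ⟨?_, by linarith [hu.2]⟩, by rw [hb]; exact huv⟩
    rcases hus.lt_or_eq with hlt | heq
    · linarith
    · -- `u = s + 1`: then `boundary v = boundary (s + 1)` with `s + 1` in the far piece
      exfalso
      refine hnot u huv ⟨?_, ?_⟩ <;> rw [← heq] <;> linarith

/-! ### Blocking: a dual cross-cut excludes open crossings -/

/-- **A dual-open cross-cut blocks open crossings** (the duality step of the RSW upper bound,
Grimmett 2018, §5.7; Bollobás–Riordan 2006, Ch. 3 §1). Let `Λ` be a cross-cut of the conformal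
rectangle `R` from `boundary s` to `boundary t` (`s < t < s + 1`) every point of which lies on the
planar dual edge `δ (e + (½, ½))` of an edge `e` open in `dualConfig ω`, and which stays within
`ρ` of `b'` or of `d'` or at depth `≥ w / 2` in `Ω`, where `2δ < w / 2` and the arcs `arc 0`,
`arc 2` are at distance `≥ ρ + 3δ` from `b'` and `d'`. If moreover frontier points within `2δ`
of `arc 0` have parameters in `(t, s + 1)`, frontier points within `2δ` of `arc 2` have
parameters in `(s, t)`, and the two discrete arcs are disjoint, then there is no open path of
`Ω_δ` from the discrete arc of `arc 0` to that of `arc 2`. Requires Newman's cross-cut theorem.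
[cite: Grimmett2018, §5.7 p. 176 and Exercise 5.6 p. 186] -/
theorem not_mem_discreteCrossing_of_crosscut (hN : Literature.Topology.PlaneTopology.Newman1939_crosscut) (R : RandomPlanarGeometry.ConformalRectangle)
    {Λ : Set ℂ} {s t : ℝ} (hst : s < t) (hts : t < s + 1)
    (hΛ : R.IsCrosscut Λ (R.boundary s) (R.boundary t))
    {δ : ℝ} (hδ : 0 < δ) {ω : BondConfig (LatticeModels.Site 2)}
    (hedge : ∀ z ∈ Λ, ∃ e ∈ dualConfig ω, z ∈ dualScale δ '' edgeTrace e)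
    {b' d' : ℂ} {ρ w : ℝ}
    (hwhere : ∀ z ∈ Λ, dist z b' ≤ ρ ∨ dist z d' ≤ ρ ∨ ball z (w / 2) ⊆ R.carrier)
    (hδw : 2 * δ < w / 2)
    (hfar0 : ∀ a ∈ R.arc 0, ρ + 3 * δ ≤ dist a b' ∧ ρ + 3 * δ ≤ dist a d')
    (hfar2 : ∀ a ∈ R.arc 2, ρ + 3 * δ ≤ dist a b' ∧ ρ + 3 * δ ≤ dist a d')
    (H0 : ∀ f ∈ frontier R.carrier, infDist f (R.arc 0) ≤ 2 * δ →
      ∃ u ∈ Ioo t (s + 1), f = R.boundary u)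
    (H2 : ∀ f ∈ frontier R.carrier, infDist f (R.arc 2) ≤ 2 * δ →
      ∃ u ∈ Ioo s t, f = R.boundary u)
    (hdisj : LatticeModels.discreteArc R.carrier δ (R.arc 0) ∩ LatticeModels.discreteArc R.carrier δ (R.arc 2) = ∅) :
    ω ∉ discreteCrossing R.carrier δ (R.arc 0) (R.arc 2) := by
  rintro ⟨x, hx, y, hy, hreach⟩
  obtain ⟨π, hπω, hπcl⟩ := exists_walk_of_reachable_openGraph_inf hreach
  have hxy : x ≠ y := by
    rintro rfl
    have : x ∈ LatticeModels.discreteArc R.carrier δ (R.arc 0) ∩ LatticeModels.discreteArc R.carrier δ (R.arc 2) := ⟨hx, hy⟩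
    rw [hdisj] at this
    exact this
  have hπn : ¬ π.Nil := fun h => hxy h.eq
  -- the two exits
  obtain ⟨x', fx, hxx', hfxfr, hfxseg, hfxcl⟩ :=
    exists_frontier_exit_of_mem_meshBoundary R.isOpen hx.1
  obtain ⟨y', fy, hyy', hfyfr, hfyseg, hfycl⟩ :=
    exists_frontier_exit_of_mem_meshBoundary R.isOpen hy.1
  have hδabs : |δ| = δ := abs_of_pos hδ
  have hx0 : infDist (LatticeModels.meshPoint δ x) (R.arc 0) ≤ δ := by
    have := Literature.Probability.Percolation.infDist_le_of_mem_discreteArc R.isOpen hx; rwa [hδabs] at this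
  have hy2 : infDist (LatticeModels.meshPoint δ y) (R.arc 2) ≤ δ := by
    have := Literature.Probability.Percolation.infDist_le_of_mem_discreteArc R.isOpen hy; rwa [hδabs] at this
  have hsegx : ∀ z ∈ segment ℝ (LatticeModels.meshPoint δ x) fx, dist z (LatticeModels.meshPoint δ x) ≤ δ := fun z hz => by
    have := dist_le_of_mem_segment_of_mem_segment hxx' hfxseg hz; rwa [hδabs] at this
  have hsegy : ∀ z ∈ segment ℝ (LatticeModels.meshPoint δ y) fy, dist z (LatticeModels.meshPoint δ y) ≤ δ := fun z hz => by
    have := dist_le_of_mem_segment_of_mem_segment hyy' hfyseg hz; rwa [hδabs] at this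
  have hsegx0 : ∀ z ∈ segment ℝ (LatticeModels.meshPoint δ x) fx, infDist z (R.arc 0) ≤ 2 * δ := fun z hz => by
    linarith [infDist_le_infDist_add_dist (s := R.arc 0) (x := z) (y := LatticeModels.meshPoint δ x), hsegx z hz]
  have hsegy2 : ∀ z ∈ segment ℝ (LatticeModels.meshPoint δ y) fy, infDist z (R.arc 2) ≤ 2 * δ := fun z hz => by
    linarith [infDist_le_infDist_add_dist (s := R.arc 2) (x := z) (y := LatticeModels.meshPoint δ y), hsegy z hz]
  obtain ⟨u', hu', hfxu⟩ := H0 fx hfxfr (hsegx0 fx (right_mem_segment ℝ _ _))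
  obtain ⟨u, hu, hfyu⟩ := H2 fy hfyfr (hsegy2 fy (right_mem_segment ℝ _ _))
  -- the connected set `P ⊆ Ω̄` joining the two arcs cut off by `Λ`
  set P : Set ℂ := (meshTrace δ π ∪ segment ℝ (LatticeModels.meshPoint δ x) fx) ∪ segment ℝ (LatticeModels.meshPoint δ y) fy
    with hP
  have hxM : LatticeModels.meshPoint δ x ∈ meshTrace δ π :=
    meshPoint_mem_meshTrace_of_mem_support hπn π.start_mem_support
  have hyM : LatticeModels.meshPoint δ y ∈ meshTrace δ π :=
    meshPoint_mem_meshTrace_of_mem_support hπn π.end_mem_support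
  have hPpre : IsPreconnected P :=
    ((isPreconnected_meshTrace δ π).union (LatticeModels.meshPoint δ x) hxM (left_mem_segment ℝ _ _)
      (convex_segment _ _).isPreconnected).union (LatticeModels.meshPoint δ y) (Or.inl hyM)
      (left_mem_segment ℝ _ _) (convex_segment _ _).isPreconnected
  have hPcl : P ⊆ closure R.carrier := by
    rintro z ((hz | hz) | hz)
    · exact hπcl hz
    · exact hfxcl hz
    · exact hfycl hz
  have hfyP : R.boundary u ∈ P := by
    rw [← hfyu]; exact Or.inr (right_mem_segment ℝ _ _)
  have hfxP : R.boundary u' ∈ P := by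
    rw [← hfxu]; exact Or.inl (Or.inr (right_mem_segment ℝ _ _))
  obtain ⟨z, hzP, hzΛ⟩ :=
    R.toJordanDomain.inter_nonempty_of_crosscut hN hst hts hΛ hPpre hPcl hu hfyP hu' hfxP
  obtain ⟨e, he, hze⟩ := hedge z hzΛ
  -- frontier points are not in `Ω`
  have hnotΩ : ∀ f ∈ frontier R.carrier, f ∉ R.carrier := fun f hf h => by
    rw [R.isOpen.frontier_eq] at hf
    exact hf.2 h
  -- shallow points far from `b'`, `d'` cannot be on `Λ`
  have hshallow : ∀ (A : Set ℂ) (f q : ℂ), A.Nonempty → f ∈ frontier R.carrier →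
      (∀ a ∈ A, ρ + 3 * δ ≤ dist a b' ∧ ρ + 3 * δ ≤ dist a d') →
      infDist z A ≤ 2 * δ → dist z q ≤ δ → dist f q ≤ δ → False := by
    intro A f q hA hf hfarA hzA hzq hfq
    obtain ⟨a, ha, hza⟩ := (infDist_lt_iff hA).1 (show infDist z A < 3 * δ by linarith)
    rcases hwhere z hzΛ with h | h | h
    · linarith [(hfarA a ha).1, dist_triangle a z b', dist_comm a z]
    · linarith [(hfarA a ha).2, dist_triangle a z d', dist_comm a z]
    · refine hnotΩ f hf (h (mem_ball.2 ?_))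
      linarith [dist_triangle f q z, dist_comm q z]
  rcases hzP with ((hz | hz) | hz)
  · -- on the open path: a primal open edge would cross a dual-open dual edge
    obtain ⟨e', he', z₀, hz₀, rfl⟩ := mem_meshTrace_iff.1 hz
    rw [image_dualScale] at hze
    obtain ⟨_, ⟨q, hq, rfl⟩, hqz⟩ := hze
    have hz₀q : z₀ = q + dualOffset := by
      have h1 : (δ : ℂ) * (q + dualOffset) = (δ : ℂ) * z₀ := by
        rw [← meshScale_apply, ← meshScale_apply δ z₀, ← hqz, meshScale_apply, meshScale_apply]
        ring
      exact (mul_left_cancel₀ (by exact_mod_cast hδ.ne') h1).symm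
    have hdis := disjoint_walkTrace_image_edgeTrace hπω he
    exact Set.disjoint_left.1 hdis (mem_walkTrace_iff.2 ⟨e', he', hz₀⟩) ⟨q, hq, hz₀q.symm⟩
  · exact hshallow (R.arc 0) fx (LatticeModels.meshPoint δ x) ⟨_, R.pt_mem_arc_self 0⟩ hfxfr hfar0
      (hsegx0 z hz) (hsegx z hz) (hsegx fx (right_mem_segment ℝ _ _))
  · exact hshallow (R.arc 2) fy (LatticeModels.meshPoint δ y) ⟨_, R.pt_mem_arc_self 2⟩ hfyfr hfar2
      (hsegy2 z hz) (hsegy z hz) (hsegy fy (right_mem_segment ℝ _ _))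

/-! ### The upper bound -/

/-- At `p = 1/2` an event and its dual pull-back have the same probability:
`P_{1/2}(dualConfig ⁻¹' A) = P_{1/2}(A)` for measurable `A` (the law of the dual configuration
under `P_{1/2}` is `P_{1/2}`, `bondPercolation_map_dualConfig_holds`). (Grimmett 1999, §11.2.)
[folklore] -/
theorem bondPercolation_half_real_preimage_dualConfig {A : Set (BondConfig (LatticeModels.Site 2))}
    (hA : MeasurableSet A) :
    (bondPercolation (LatticeModels.zdGraph 2) half).real (dualConfig ⁻¹' A) =
      (bondPercolation (LatticeModels.zdGraph 2) half).real A := by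
  simp only [measureReal_def]
  rw [← Measure.map_apply measurable_dualConfig hA, bondPercolation_map_dualConfig_holds half,
    symm_half]

/-- **RSW upper bound for conformal rectangles** (the "bounded away from `1`" half of
Grimmett 2018, §5.7 / Exercise 5.6, for H21's discretisation `discreteCrossing`, from the named
facts `rsw_half`, `Grimmett1999_openCircuitAround_half` (Grimmett 1999 §11.7), the Jordan curve
theorem and Newman's cross-cut theorem): for every conformal rectangle `R` there are `c₂ < 1`
and `δ₀ > 0` with `P_{1/2}[C_δ(Ω; arc 0, arc 2)] ≤ c₂` for all `0 < δ < δ₀`. Proof: with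
probability `≥ c' > 0` (duality at `p = 1/2`, translation invariance, RSW, annulus circuits,
Harris–FKG) the dual configuration contains the chain of circuits and long crossings of
`exists_dual_crosscut` from `arc 1°` to `arc 3°`; the resulting dual cross-cut blocks every open
crossing (`not_mem_discreteCrossing_of_crosscut`). No hypothesis on the boundary measure is
needed for this half. [cite: Grimmett2018, §5.7 p. 176 and Exercise 5.6 p. 186] -/
theorem discreteCrossingProb_upperBound (hRSW : Literature.Probability.Percolation.rsw_half)
    (hO : Literature.Probability.Percolation.Grimmett1999_openCircuitAround_half) (hJ : Literature.Topology.PlaneTopology.JordanCurveTheorem)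
    (hN : Literature.Topology.PlaneTopology.Newman1939_crosscut) (R : RandomPlanarGeometry.ConformalRectangle) :
    ∃ c₂ δ₀ : ℝ, c₂ < 1 ∧ 0 < δ₀ ∧ ∀ δ : ℝ, 0 < δ → δ < δ₀ →
      discreteCrossingProb half R.carrier δ (R.arc 0) (R.arc 2) ≤ c₂ := by
  obtain ⟨b', d', r, w, N, c, hr, hw, hwr, hb', hd', hrb, hrb', hrd, hrd', hbd, hc0, hcN, hstep,
    hball⟩ := exists_chainData R (i := 1) (i' := 3) (by decide)
  obtain ⟨cO, hcO, -, hcOl⟩ := hO.const_le_one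
  obtain ⟨cX, hcX, hcXl⟩ := hRSW.ratio (k := 20) (by norm_num)
  obtain ⟨h0, h01, h12, h23, h3⟩ := mark_chain R
  -- continuity modulus of the boundary loop at scale `r / 2`
  obtain ⟨η, hη, -, hηc⟩ := exists_forall_dist_boundary_lt R (half_pos hr)
  -- the far boundary pieces keep a positive distance from `arc 0`, `arc 2`
  obtain ⟨ε₀, hε₀, hfar₀⟩ := LatticeModels.exists_pos_forall_lt_infDist
    (isCompact_Icc.image R.continuous_boundary) (R.isClosed_arc 0)
    (disjoint_image_Icc_arc_zero R hη) ⟨_, R.pt_mem_arc_self 0⟩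
  obtain ⟨ε₂, hε₂, hfar₂⟩ := LatticeModels.exists_pos_forall_lt_infDist
    (isCompact_Icc.image R.continuous_boundary) (R.isClosed_arc 2)
    (disjoint_image_Icc_arc_two R hη) ⟨_, R.pt_mem_arc_self 2⟩
  -- disjointness of the discrete arcs
  obtain ⟨ε', hε', hε'd⟩ := R.exists_pos_forall_lt_dist_arc
  set c' : ℝ := cO ^ (N + 1) * cX ^ N * cO * cO with hc'
  have hc'pos : 0 < c' := by positivity
  refine ⟨1 - c', min (min (w / 200) (min (ε₀ / 3) (ε₂ / 3))) (ε' / 2), by linarith,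
    lt_min (lt_min (by positivity) (lt_min (by positivity) (by positivity))) (by positivity),
    fun δ hδ hδlt => ?_⟩
  have hδw : δ ≤ w / 200 := (hδlt.trans_le ((min_le_left _ _).trans (min_le_left _ _))).le
  have hδε₀ : δ < ε₀ / 3 :=
    hδlt.trans_le ((min_le_left _ _).trans ((min_le_right _ _).trans (min_le_left _ _)))
  have hδε₂ : δ < ε₂ / 3 :=
    hδlt.trans_le ((min_le_left _ _).trans ((min_le_right _ _).trans (min_le_right _ _)))
  have hδε' : δ < ε' / 2 := hδlt.trans_le (min_le_right _ _)
  -- the scales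
  obtain ⟨hm1, hmw, hmw'⟩ := floor_scale_bounds hδ hδw
  obtain ⟨hL1, hLr, hLr'⟩ := floor_scale_bounds' hδ (by linarith : δ ≤ r / 40)
  set m : ℕ := ⌊w / (40 * δ)⌋₊ with hm
  set L : ℕ := ⌊r / (20 * δ)⌋₊ with hL
  set τ : ℂ := (δ : ℂ) * dualOffset with hτ
  set A : Set (BondConfig (LatticeModels.Site 2)) :=
    (((⋂ k ∈ Finset.range (N + 1),
        openCircuitAroundAt (LatticeModels.nearestSite δ (c k - τ)) (2 * m)) ∩
      ⋂ k ∈ Finset.range N,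
        lrCrossingAt (LatticeModels.nearestSite δ (c k - τ) - ![(10 * m : ℤ), 0]) (20 * m) m) ∩
      openCircuitAroundAt (LatticeModels.nearestSite δ (b' - τ)) L) ∩
        openCircuitAroundAt (LatticeModels.nearestSite δ (d' - τ)) L with hA
  set P := bondPercolation (LatticeModels.zdGraph 2) half with hP
  have hAmeas : MeasurableSet A :=
    measurableSet_chainEvents δ m L N (fun k => c k - τ) (b' - τ) (d' - τ)
  have hPA : c' ≤ P.real A :=
    le_real_chainEvents hcO hcX hcOl (fun l hl => (hcXl l hl).1) δ hm1 hL1 N (fun k => c k - τ)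
      (b' - τ) (d' - τ)
  have hPA' : c' ≤ P.real (dualConfig ⁻¹' A) := by
    rw [hP, bondPercolation_half_real_preimage_dualConfig hAmeas]; exact hPA
  -- on the dual event there is no open crossing
  have hρ : 3 * Real.sqrt 2 * L * δ ≤ 9 / 2 * (r / 20) := three_sqrt_two_mul_le hδ.le hLr
  have hblock : ∀ ω : BondConfig (LatticeModels.Site 2), ω ∈ dualConfig ⁻¹' A →
      ω ∉ discreteCrossing R.carrier δ (R.arc 0) (R.arc 2) := by
    rintro ω ⟨⟨⟨h₁, h₂⟩, h₃⟩, h₄⟩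
    obtain ⟨Λ, s, t, hs, ht, hΛ, hedge, hwhere⟩ := exists_dual_crosscut hJ R hwr hb' hd' hrb hrb'
      hrd hrd' hbd hc0 hcN hstep hball hδ hδw hm1 hmw hmw' hL1 hLr hLr'
      (fun k hk => mem_iInter₂.1 h₁ k (Finset.mem_range.2 (Nat.lt_succ_of_le hk)))
      (fun k hk => mem_iInter₂.1 h₂ k (Finset.mem_range.2 hk)) h₃ h₄
    set ρ : ℝ := 3 * Real.sqrt 2 * L * δ + 2 * δ with hρdef
    have hρr : ρ < r / 2 := by rw [hρdef]; linarith
    -- the end-points of `Λ` are near `b'`, `d'`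
    have hnotΩ : ∀ f ∈ frontier R.carrier, f ∉ R.carrier := fun f hf h => by
      rw [R.isOpen.frontier_eq] at hf
      exact hf.2 h
    have hsb : dist (R.boundary s) b' ≤ ρ := by
      have hs1 : R.boundary s ∈ R.arc 1 := ⟨s, ⟨hs.1.le, by rw [R.nextMark_one]; exact hs.2.le⟩, rfl⟩
      rcases hwhere _ hΛ.1.left_mem with h | h | h
      · exact h
      · have := hrd' 1 (by decide) _ hs1; linarith
      · exact absurd (h (mem_ball_self (by linarith))) (hnotΩ _ (R.boundary_mem_frontier s))
    have htd : dist (R.boundary t) d' ≤ ρ := by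
      have ht3 : R.boundary t ∈ R.arc 3 :=
        ⟨t, ⟨ht.1.le, by rw [R.nextMark_three]; exact ht.2.le⟩, rfl⟩
      rcases hwhere _ hΛ.1.right_mem with h | h | h
      · have := hrb' 3 (by decide) _ ht3; linarith
      · exact h
      · exact absurd (h (mem_ball_self (by linarith))) (hnotΩ _ (R.boundary_mem_frontier t))
    obtain ⟨hs', hs'', ht', ht''⟩ :=
      crosscut_param_bounds R hrb' hrd' hρr hηc hs ht hsb htd
    refine not_mem_discreteCrossing_of_crosscut hN R (by linarith [hs.2, ht.1])
      (by linarith [hs.1, ht.2]) hΛ hδ hedge hwhere (by linarith) ?_ ?_ ?_ ?_ ?_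
    · intro a ha
      exact ⟨by linarith [hrb' 0 (by decide) a ha], by linarith [hrd' 0 (by decide) a ha]⟩
    · intro a ha
      exact ⟨by linarith [hrb' 2 (by decide) a ha], by linarith [hrd' 2 (by decide) a ha]⟩
    · intro f hf hfd
      exact exists_Ioo_of_infDist_arc_zero R hfar₀ hs' ht'' hf (by linarith)
    · intro f hf hfd
      exact exists_Ioo_of_infDist_arc_two R hfar₂ hs' hs'' ht' hf (by linarith)
    · refine Literature.Probability.Percolation.discreteArc_inter_eq_empty_of_lt R hε'd ?_
      rw [abs_of_pos hδ]; linarith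
  -- probability bookkeeping
  have hdisj : Disjoint (discreteCrossing R.carrier δ (R.arc 0) (R.arc 2)) (dualConfig ⁻¹' A) :=
    disjoint_left.2 fun ω hω hA => hblock ω hA hω
  have hunion := measureReal_union hdisj (measurable_dualConfig hAmeas) (μ := P)
  have hle1 : P.real (discreteCrossing R.carrier δ (R.arc 0) (R.arc 2) ∪ dualConfig ⁻¹' A) ≤ 1 :=
    measureReal_le_one
  change P.real (discreteCrossing R.carrier δ (R.arc 0) (R.arc 2)) ≤ 1 - c'
  linarith

/-! ### Assembly: the corrected fact from the named facts -/

/-- **The corrected RSW fact for conformal rectangles, from the named literature facts.**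
`discreteCrossingProb_bounds_nullFrontier` (Grimmett 2018, §5.7 / Ex. 5.5–5.6: the crossing
probability of a conformal rectangle with Lebesgue-null boundary is bounded away from `0` and
`1` uniformly in small `δ`, for H21's discretisation `meshDomain` = largest mesh component)
follows from the `ℤ²` RSW box-crossing property at `1/2` (`rsw_half`), the RSW annulus-circuit
bound (`Grimmett1999_openCircuitAround_half`, Grimmett 1999 (11.72)), the Jordan curve theorem
(`JordanCurveTheorem`) and Newman's cross-cut theorem (`Newman1939_crosscut`): the lower bound is
`discreteCrossingProb_lowerBound_of_nullFrontier`, the upper bound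
`discreteCrossingProb_upperBound`. [cite: Grimmett2018, §5.7 p. 176 and Exercises 5.5–5.6 p. 186] -/
theorem discreteCrossingProb_bounds_nullFrontier_of (hRSW : Literature.Probability.Percolation.rsw_half)
    (hO : Literature.Probability.Percolation.Grimmett1999_openCircuitAround_half) (hJ : Literature.Topology.PlaneTopology.JordanCurveTheorem)
    (hN : Literature.Topology.PlaneTopology.Newman1939_crosscut) : Literature.Probability.Percolation.discreteCrossingProb_bounds_nullFrontier := by
  intro R hR
  obtain ⟨c₁, δ₁, hc₁, hδ₁, hlow⟩ := discreteCrossingProb_lowerBound_of_nullFrontier hRSW hO hJ R hR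
  obtain ⟨c₂, δ₂, hc₂, hδ₂, hup⟩ := discreteCrossingProb_upperBound hRSW hO hJ hN R
  exact ⟨c₁, c₂, min δ₁ δ₂, hc₁, hc₂, lt_min hδ₁ hδ₂, fun δ hδ hδlt =>
    ⟨hlow δ hδ (hδlt.trans_le (min_le_left _ _)), hup δ hδ (hδlt.trans_le (min_le_right _ _))⟩⟩

/-- **The corrected RSW fact from the three remaining named facts.** Since the `ℤ²` box-crossing
property `rsw_half` is proved in the tree (`Literature.Probability.Percolation.rsw_half_holds`, `RSWLemma.lean`, after
Bollobás–Riordan 2006, Ch. 3), `discreteCrossingProb_bounds_nullFrontier` follows from the RSW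
annulus-circuit bound `Grimmett1999_openCircuitAround_half` (Grimmett 1999, (11.72)), the Jordan
curve theorem and Newman's cross-cut theorem alone. [cite: Grimmett2018, §5.7 p. 176 and Exercises 5.5–5.6 p. 186] -/
theorem discreteCrossingProb_bounds_nullFrontier_of_facts
    (hO : Literature.Probability.Percolation.Grimmett1999_openCircuitAround_half) (hJ : Literature.Topology.PlaneTopology.JordanCurveTheorem)
    (hN : Literature.Topology.PlaneTopology.Newman1939_crosscut) : Literature.Probability.Percolation.discreteCrossingProb_bounds_nullFrontier :=
  discreteCrossingProb_bounds_nullFrontier_of Literature.Probability.Percolation.rsw_half_holds hO hJ hN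

/-- **The corrected RSW fact from the Jordan curve theorem and Newman's cross-cut theorem
alone.** With `rsw_half_holds` (`RSWLemma.lean`) and the annulus-circuit bound
`Grimmett1999_openCircuitAround_half_holds` (`AnnulusCircuitsProofs.lean`, Grimmett 1999
(11.72)) both proved in the tree, the only remaining hypotheses of
`discreteCrossingProb_bounds_nullFrontier` are the two plane-topology facts
`JordanCurveTheorem` (`JordanCurve.lean`) and `Newman1939_crosscut` (`Crosscut.lean`), neither of
which is in Mathlib. [cite: Grimmett2018, §5.7 p. 176 and Exercises 5.5–5.6 p. 186] -/
theorem discreteCrossingProb_bounds_nullFrontier_of_JCT (hJ : Literature.Topology.PlaneTopology.JordanCurveTheorem)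
    (hN : Literature.Topology.PlaneTopology.Newman1939_crosscut) : Literature.Probability.Percolation.discreteCrossingProb_bounds_nullFrontier :=
  discreteCrossingProb_bounds_nullFrontier_of Literature.Probability.Percolation.rsw_half_holds
    Literature.Probability.Percolation.Grimmett1999_openCircuitAround_half_holds hJ hN

/-- **Cluster points in `(0, 1)` from the two plane-topology facts**, for conformal rectangles
with Lebesgue-null boundary: the statement of `Literature.Probability.Percolation.discreteCrossingProb_clusterPt_mem_Ioo`
under the proviso `volume (frontier Ω) = 0`, assuming only `JordanCurveTheorem` and
`Newman1939_crosscut`. [cite: Grimmett2018, §5.7 p. 176 and Exercise 5.6 p. 186] -/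
theorem discreteCrossingProb_clusterPt_mem_Ioo_of_JCT (hJ : Literature.Topology.PlaneTopology.JordanCurveTheorem)
    (hN : Literature.Topology.PlaneTopology.Newman1939_crosscut) (R : RandomPlanarGeometry.ConformalRectangle) (hR : volume (frontier R.carrier) = 0)
    {a : ℝ} (ha : MapClusterPt a (𝓝[>] 0) fun δ =>
      discreteCrossingProb half R.carrier δ (R.arc 0) (R.arc 2)) :
    a ∈ Ioo (0 : ℝ) 1 :=
  (discreteCrossingProb_bounds_nullFrontier_of_JCT hJ hN).clusterPt_mem_Ioo R hR ha

/-- **The upper half of `discreteCrossingProb_clusterPt_mem_Ioo` for every conformal rectangle,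
from the two plane-topology facts**: every subsequential limit of the crossing probability is
`< 1`. [cite: Grimmett2018, §5.7 p. 176 and Exercise 5.6 p. 186] -/
theorem lt_one_of_mapClusterPt_discreteCrossingProb_of_JCT (hJ : Literature.Topology.PlaneTopology.JordanCurveTheorem)
    (hN : Literature.Topology.PlaneTopology.Newman1939_crosscut) (R : RandomPlanarGeometry.ConformalRectangle)
    {a : ℝ} (ha : MapClusterPt a (𝓝[>] 0) fun δ =>
      discreteCrossingProb half R.carrier δ (R.arc 0) (R.arc 2)) :
    a < 1 := by
  obtain ⟨c₂, δ₂, hc₂, hδ₂, hup⟩ := discreteCrossingProb_upperBound Literature.Probability.Percolation.rsw_half_holds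
    Literature.Probability.Percolation.Grimmett1999_openCircuitAround_half_holds hJ hN R
  have hev : ∀ᶠ δ in 𝓝[>] (0 : ℝ),
      discreteCrossingProb half R.carrier δ (R.arc 0) (R.arc 2) ∈ Iic c₂ := by
    filter_upwards [Ioo_mem_nhdsGT hδ₂] with δ hδ
    exact hup δ hδ.1 hδ.2
  exact (isClosed_Iic.mem_of_mapClusterPt ha hev).trans_lt hc₂

/-- **Cluster points of conformal-rectangle crossing probabilities lie in `(0, 1)`** for
conformal rectangles with Lebesgue-null boundary curve — the statement of
`Literature.Probability.Percolation.discreteCrossingProb_clusterPt_mem_Ioo` under the proviso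
`volume (frontier Ω) = 0` (which covers rectifiable, e.g. polygonal or piecewise smooth,
boundaries), from the same four named facts. [cite: Grimmett2018, §5.7 p. 176 and Exercise 5.6 p. 186] -/
theorem discreteCrossingProb_clusterPt_mem_Ioo_of_nullFrontier (hRSW : Literature.Probability.Percolation.rsw_half)
    (hO : Literature.Probability.Percolation.Grimmett1999_openCircuitAround_half) (hJ : Literature.Topology.PlaneTopology.JordanCurveTheorem)
    (hN : Literature.Topology.PlaneTopology.Newman1939_crosscut) (R : RandomPlanarGeometry.ConformalRectangle) (hR : volume (frontier R.carrier) = 0)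
    {a : ℝ} (ha : MapClusterPt a (𝓝[>] 0) fun δ =>
      discreteCrossingProb half R.carrier δ (R.arc 0) (R.arc 2)) :
    a ∈ Ioo (0 : ℝ) 1 :=
  (discreteCrossingProb_bounds_nullFrontier_of hRSW hO hJ hN).clusterPt_mem_Ioo R hR ha

/-- **The upper half of `discreteCrossingProb_clusterPt_mem_Ioo` holds for every conformal
rectangle**: every subsequential limit as `δ → 0⁺` of the crossing probability is `< 1` (from
`rsw_half`, `Grimmett1999_openCircuitAround_half`, the Jordan curve theorem and Newman's
cross-cut theorem; no hypothesis on the boundary measure). [cite: Grimmett2018, §5.7 p. 176 and Exercise 5.6 p. 186] -/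
theorem lt_one_of_mapClusterPt_discreteCrossingProb (hRSW : Literature.Probability.Percolation.rsw_half)
    (hO : Literature.Probability.Percolation.Grimmett1999_openCircuitAround_half) (hJ : Literature.Topology.PlaneTopology.JordanCurveTheorem)
    (hN : Literature.Topology.PlaneTopology.Newman1939_crosscut) (R : RandomPlanarGeometry.ConformalRectangle)
    {a : ℝ} (ha : MapClusterPt a (𝓝[>] 0) fun δ =>
      discreteCrossingProb half R.carrier δ (R.arc 0) (R.arc 2)) :
    a < 1 := by
  obtain ⟨c₂, δ₂, hc₂, hδ₂, hup⟩ := discreteCrossingProb_upperBound hRSW hO hJ hN R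
  have hev : ∀ᶠ δ in 𝓝[>] (0 : ℝ),
      discreteCrossingProb half R.carrier δ (R.arc 0) (R.arc 2) ∈ Iic c₂ := by
    filter_upwards [Ioo_mem_nhdsGT hδ₂] with δ hδ
    exact hup δ hδ.1 hδ.2
  exact (isClosed_Iic.mem_of_mapClusterPt ha hev).trans_lt hc₂

end

end Literature.Probability.Percolation
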